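import Mathlib
import Literature.Analysis.Convex.PrimalDualHybridGradient
import Literature.Analysis.Convex.PrimalDualRestartSharpness
import HarnessLib

/-!
# Restarted PDHG: Property 3 of the averaged Chambolle–Pock iteration and its linear convergence
# on sharp problems (Applegate–Hinder–Lu–Lubin, *Math. Program.* 201 (2023) 133–184, §2, §4)

Topic `Literature/Analysis/Convex` (companion of `PrimalDualHybridGradient.lean` — the PDHG step
`pdhgStep`, its metric `M_{τ,σ}` = `metricM`, the Fejér inequality `fejer_step`, the conic Lagrangian
`conicL`, the averaged iterates `xAvg`/`yAvg` and the ergodic rate `conicL_gap_ergodic_le` — and of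
`PrimalDualRestartSharpness.lean`, which records [ApplegateEtAl2022, Theorem 1] over an ABSTRACT gap
function on a pseudo-metric space). Namespace `Literature.Analysis.Convex.RestartedPDHG`. Everything
is PROVED; no named facts.

Source. D. Applegate, O. Hinder, H. Lu, M. Lubin, *Faster first-order primal-dual methods for linear
programming using restarts and sharpness*, Math. Program. 201 (2023) 133–184,
doi:10.1007/s10107-022-01901-9 = arXiv:2105.12715 [ApplegateEtAl2022] (held, `lit` key
`paper:arxiv-2105.12715`; read at p0004 (the normalized duality gap (4)), p0007 (§2, the generic
update (3) and the PDHG footnote on different step sizes), p0008 (Property 1, Propositions 1–3,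
Property 2), p0009 (Property 3, Proposition 4 with proof), p0010 (Definition 1), p0013 (Algorithm 1
"we initialize with `z^{0,0} ∈ Z`", `t* = ⌈2C(q+2)/(αβ)⌉`, Proposition 8, Theorem 1 with proof)).

THE PRINTED STATEMENTS, for PDHG. [§1 (4)] the normalized duality gap
`ρ_r(z) := (1/r) · max_{ẑ ∈ W_r(z)} {L(x, ŷ) − L(x̂, y)}`, `W_r(z)` "the ball centered at `z` with
radius `r` intersected with the set `Z`", `‖·‖` "a carefully selected semi-norm on `Z`";
[Prop. 1] PDHG satisfies Property 1 (`L(x̃^{t+1}, y) − L(x, ỹ^{t+1}) ≤ (C/2)‖z − z^t‖² − (C/2)‖z − z^{t+1}‖²`)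
with `C = 1/η` and `‖z‖² = zᵀ M z`, `M = [[I, −ηAᵀ], [−ηA, I]]`, `0 < η ≤ 1/σ_max(A)`; [Prop. 2]
Property 1 ⇒ (i) `‖z^{t+1} − z*‖ ≤ ‖z^t − z*‖`, (ii) `L(x̄^t, y) − L(x, ȳ^t) ≤ C‖z − z⁰‖²/(2t)`;
[Prop. 3] PDHG has `z̃^t = z^t`, `q = 0`; [Property 3] "(i) `ρ_{‖z̄^t − z⁰‖}(z̄^t) ≤ 2C‖z̄^t − z⁰‖/t`,
(ii) `‖z̄^t − z⁰‖ ≤ (q + 2) dist(z⁰, Z*)`" for the averaged output `z̄^t = t⁻¹ Σ_{i=1}^t z̃^i ∈ Z`;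
[Prop. 4] Properties 1 + 2 ⇒ Property 3 (proof: `W_r(z̄^t) ⊆ W_{2r}(z⁰)` for `r = ‖z̄^t − z⁰‖`, then
Prop. 2 (ii); and `‖z̃^t − z⁰‖ ≤ ‖z̃^t − z^i‖ + ‖z^i − z*‖ + ‖z* − z⁰‖ ≤ (q + 2)‖z⁰ − z*‖`, averaged);
[Def. 1] `α`-sharp on `S ⊆ Z`: `α dist(z, Z*) ≤ ρ_r(z)` for all `z ∈ S`, `r ∈ (0, diam S]`;
[Prop. 8] under Property 3, `‖z̄^{n,t} − z^{n,0}‖ = 0 ⇒ z̄^{n,t} ∈ Z*`; [Thm. 1] with fixed-frequency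
restarts `t ≥ t*`, `β ∈ (0, 1)`, and `α`-sharpness on `W_R(z^{0,0})`, `R = (q+2)/(1−β) · dist(z^{0,0}, Z*)`:
`dist(z^{n,0}, Z*) ≤ βⁿ dist(z^{0,0}, Z*)`.

WHAT IS TYPED (the constrained bilinear saddle `L(x, y) = ⟨c, x⟩ + ⟨Kx, y⟩ − ⟨b, y⟩` on closed
convex `C × D`, i.e. the conic/LP saddle of PDLP-type solvers, with PDHG run through the resolvent maps
of `c + N_C`, `b + N_D` — e.g. the projections `P_C(· − τc)`, `P_D(· − σb)` — and general step sizes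
`τ, σ > 0`, `τσ‖K‖² ≤ 1` (the paper's footnote in §2: "our results can easily extend to the case of
different step sizes by rescaling"); in the `M_{τ,σ}`-seminorm the constants are `C = 1`, `q = 0`):

* `bM`, `qM`, **`normM`** — `⟨u, v⟩_M`, `‖d‖²_M`, `‖d‖_M = √⟨d, M_{τ,σ} d⟩` on `X × Y`; it IS a semi-norm
  for `τσ‖K‖² ≤ 1`: `normM_smul`, Cauchy–Schwarz `bM_le_normM_mul`, **`normM_add_le`**, `normM_sum_le`;
  and a norm for `τσ‖K‖² < 1`: `euclidean_le_normM_sq`, `eq_zero_of_normM_eq_zero`.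
* `saddleSet` (`Z*`, via the tree's `mem_zer_kkt_conic_iff_saddle`), `pdhgIter_fst_mem`/`_snd_mem`
  (iterates are feasible), **`normM_pdhgStep_sub_le`**, `normM_pdhgIter_sub_le` = Prop. 2 (i).
* `avgPDHG` (the restart map `z⁰ ↦ z̄^t`), `gap` (`G(z; ζ) = L(x, η) − L(ξ, y)`), `avgPDHG_fst_mem`/
  `_snd_mem` (`z̄^t ∈ Z`), **`gap_avgPDHG_le`** = Prop. 2 (ii) in the form `G(z̄^t; ζ) ≤ ‖ζ − z⁰‖²_M/(2t)`.
* **Property 3 for PDHG = Prop. 4**: `normM_avgPDHG_sub_le` (`‖z̄^t − z⁰‖_M ≤ 2‖z⁰ − z*‖_M` for every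
  saddle point) and `normM_avgPDHG_sub_le_infDistM` (`≤ 2 dist_M(z⁰, Z*)`) = Property 3 (ii);
  `gap_avgPDHG_le_of_normM_le` (`G(z̄^t; ζ) ≤ (ρ + r)²/(2t)` on `W_ρ(z̄^t)`, `r = ‖z̄^t − z⁰‖_M`),
  `gap_avgPDHG_le_two_mul_sq` and **`rho_avgPDHG_le`** (`ρ_r(z̄^t) ≤ 2r/t`) = Property 3 (i), where
  `rho` is the normalized duality gap (4) in the `M`-geometry, `infDistM` = `dist_M(·, S)`,
  `ballM` = the feasible ball `W_R(z⁰)`, `diamM` = `diam`.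
* `gap_add_smul_sub`, **`avgPDHG_mem_saddleSet_of_normM_eq_zero`** = Prop. 8 for PDHG (degenerate
  restart: `‖z̄^t − z⁰‖_M = 0 ⇒ z̄^t ∈ Z*`), proved directly from Property 3 (i) by scaling along
  feasible segments (no definiteness of `M` needed).
* `IsSharpOn` = Def. 1 in the `M`-geometry; `isSharpOn_ballM_of_le_two_mul` (`diam W_R ≤ 2R`);
  `normM_iterate_avgPDHG_sub_le` (first display of the proof of Thm 1: the restarts stay in
  `W_R(z^{0,0})`, `R = 2/(1−β) dist_M(z^{0,0}, Z*)`); **`infDistM_iterate_avgPDHG_le_pow`** = THEOREM 1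
  for restarted PDHG: `dist_M(z^{n,0}, Z*) ≤ βⁿ dist_M(z^{0,0}, Z*)` whenever `4/(αt) ≤ β`
  (`t ≥ t*`), `z^{0,0} ∈ C × D`, `Z* ≠ ∅`, and the problem is `α`-sharp on `W_R(z^{0,0})`;
  `infDistM_iterate_avgPDHG_le_of_pow_le` (the `O(log(1/ε))` reading).
* ADAPTIVE restarts = [ApplegateEtAl2022, Theorem 2] for PDHG (the restart rule of PDLP-type solvers:
  restart when `ρ_{‖z̄ − z^{n,0}‖}(z̄) ≤ β ρ_{‖z^{n,0} − z^{n−1,0}‖}(z^{n,0})`): `adaptive_condition_avgPDHG`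
  (the criterion is met at every inner length `t₁` with `4/(αt₁) ≤ β`), `adaptive_length_avgPDHG_le`
  (Thm 2 (i): first-hit restart lengths are `≤ t*`), **`infDistM_adaptive_avgPDHG_le`** (Thm 2 (ii):
  `dist_M(z^{n+1,0}, Z*) ≤ βⁿ (4/(ατ₀)) dist_M(z^{0,0}, Z*)`), all relative to `α`-sharpness on a
  feasible ball containing the restart points.
* [ApplegateEtAl2022, Proposition 9] (PDHG case): the restart points of restarted PDHG — for ANY
  restart lengths — stay in the feasible `M`-ball `W_R(z^{0,0})`, `R = 2‖z^{0,0} − z*‖_M` for every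
  saddle point `z*` (`normM_avgPDHG_sub_saddle_le` = Fejér monotonicity survives averaging,
  `normM_restart_sub_saddle_le`, **`restart_mem_ballM`**, `restart_mem_ballM_of_lt` = any
  `R > 2 dist_M(z^{0,0}, Z*)`), which is the ball on which Theorem 2 asks for sharpness; and
  [ApplegateEtAl2022, Remark 3] (iteration count): `four_div_le_of_le_nat`/`ceil_restart_ne_zero`
  (`t* = ⌈4/(αβ)⌉` satisfies `4/(αt*) ≤ β`), `pow_mul_le_of_log_le`,
  `infDistM_iterate_avgPDHG_le_of_log_le` and **`infDistM_iterate_avgPDHG_ceil_le`**: `n` restarts of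
  length `⌈4/(αβ)⌉` with `log(dist_M(z^{0,0}, Z*)/ε) ≤ n log(1/β)` — `n⌈4/(αβ)⌉ = O((1/α) log(1/ε))`
  PDHG steps — give `dist_M(z^{n,0}, Z*) ≤ ε`.
* [ApplegateEtAl2022, §3: Facts 1–2, Propositions 5–6] (basic properties of `ρ_r`, for `τσ‖K‖² < 1` so
  that `M`-balls are bounded): `gap_eq_inner_displacement`, `norm_fst_snd_le_of_normM_le`,
  `bddAbove_gap_ball` (the sup in `ρ_r` is a genuine supremum), `rho_nonneg`, **`mul_rho_mono`**
  (Fact 1: `r ρ_r(z)` non-decreasing), **`rho_antitone`** (Prop. 5: `ρ_r(z)` non-increasing in `r`,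
  `C`, `D` convex), **`rho_eq_zero_iff_mem_saddleSet`** (Prop. 6: `ρ_r(z) = 0 ⇔ z ∈ Z*` at feasible
  `z`), `diamM_mono_ballM` and **`IsSharpOn.mono_ballM`** (Fact 2: sharpness on `W_R(z⁰)` passes to
  subsets).

* **Sharpness with slack = [XiongFreund2024, Theorem 3.5]** (Z. Xiong, R. M. Freund, arXiv:2406.01942
  (2024), §3.2) for restarted PDHG: under the RELAXED hypothesis
  `dist_M(z^{n,0}, Z*) ≤ L·ρ_{‖z^{n,0} − z^{n−1,0}‖}(z^{n,0}) + C'` at the restart points (their (3.19))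
  the first-hit adaptive scheme satisfies `adaptive_condition_avgPDHG_of_slack` /
  `adaptive_length_avgPDHG_le_of_slack` (`τ_n ≤ ⌊4(L + C'/g_{n−1})/β⌋ + 1`),
  `first_potential_avgPDHG_le`, **`sum_adaptive_lengths_avgPDHG_le_of_slack`**
  (`Σ_{n<N} τ_n ≤ τ_0 + (N−1)(1 + 4L/β) + 4C'/(β ε (1−β))` PDHG steps before the first potential `≤ ε`)
  and `restart_count_lt_of_potentials_gt_avgPDHG` (`(N−2) log(1/β) < log(4 dist_M(z^{0,0}, Z*)/(τ_0 ε))`)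
  = the printed `T ≤ 23L ln(23 dist/ε) + 35C/ε`: linear down to the scale `C'`, `O(C'/ε)` below. This is
  the form of the restart theorem that applies to SDP legs, where `C' > 0` comes from the sublevel-set
  geometry (`SublevelSetGeometry.lean`, [XiongFreund2024, Lemmas 3.2, 3.12]).

Deviations from print, all inessential: (a) general `τ, σ` (above); (b) the paper closes `ρ_r` at
`r = 0` by `ρ_0 := limsup_{r→0⁺} ρ_r` and uses it only through Prop. 8 — here `rho 0 z = 0` by the
`0⁻¹ = 0` convention and Prop. 8's CONCLUSION is proved directly, so Theorem 1 needs sharpness only for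
`r ∈ (0, diam S]` exactly as in Def. 1; (c) `dist(z, Z*)` is the infimum `infDistM` (no attainment is
used: Property 3 (ii) is proved against every `z* ∈ Z*` and then against the infimum).

Deliberately NOT here (separate printed statements): that LP is sharp with `α = 1/(H(K)·…)`
[ApplegateEtAl2022, Lemma 5] (via Hoffman's bound — see `Literature/Analysis/Convex/HoffmanErrorBound.lean`
and the LP sharpness file built on it), sharpness of unconstrained bilinear problems [Lemma 3] and of
bounded problems [Lemma 1], the lower bounds of §5, and the PPM/EGM/ADMM rows of Table 1 (and
Proposition 10, the EGM/ADMM analogue of Proposition 9). READING FOR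
SEMIDEFINITE CONES: the theorem is relative to `α`-sharpness, which is printed for polyhedral `C × D`
(LP) and is false in general for spectrahedra without further regularity (Sturm's error bounds are
Hölder, cf. `Literature/Computation/Certificates/SturmErrorBound.lean`); nothing here asserts
sharpness of an SDP saddle.
-/

namespace Literature.Analysis.Convex.RestartedPDHG

open scoped RealInnerProductSpace
open Literature.Analysis.Convex.MonotoneOperator (IsMonotone resolvent IsResolventMap zer
  mem_resolvent_iff mem_zer_iff)
open Literature.Analysis.Convex.PrimalDualHybridGradient
open Literature.Analysis.Convex.DouglasRachford (normalCone mem_normalCone_iff isMonotone_normalCone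
  isResolventMap_proj)

variable {X Y : Type*} [NormedAddCommGroup X] [InnerProductSpace ℝ X] [CompleteSpace X]
  [NormedAddCommGroup Y] [InnerProductSpace ℝ Y] [CompleteSpace Y]

/-! ### The `M`-seminorm of the PDHG analysis -/

/-- The bilinear form of the PDHG metric on `X × Y`: `⟨u, v⟩_M = ⟨u, M_{τ,σ} v⟩`.
[cite: ApplegateEtAl2022, Proposition 1 (PDHG: ‖z‖² = zᵀMz)] [cite: ChambollePock2015, §3 (12)] -/
noncomputable def bM (K : X →L[ℝ] Y) (τ σ : ℝ) (u v : X × Y) : ℝ :=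
  ⟪WithLp.toLp 2 u, metricM K τ σ (WithLp.toLp 2 v)⟫

/-- The quadratic form `‖d‖²_M = ⟨d, M_{τ,σ} d⟩` of the PDHG metric on `X × Y`.
[cite: ApplegateEtAl2022, Proposition 1 (PDHG: ‖z‖² = zᵀMz)] [cite: ChambollePock2015, §3 (12)] -/
noncomputable def qM (K : X →L[ℝ] Y) (τ σ : ℝ) (d : X × Y) : ℝ := bM K τ σ d d

/-- **The `M`-seminorm** `‖d‖_M = √⟨d, M_{τ,σ} d⟩` — the "carefully selected semi-norm" of the
restart analysis for PDHG (`‖z‖² = zᵀ M z`, `M = [[I, −ηAᵀ], [−ηA, I]]/η` in the paper's normalization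
`τ = σ = η`; here general `τ, σ`). [cite: ApplegateEtAl2022, Proposition 1 (PDHG) and §1 (4)] -/
noncomputable def normM (K : X →L[ℝ] Y) (τ σ : ℝ) (d : X × Y) : ℝ := Real.sqrt (qM K τ σ d)

omit [CompleteSpace X] [CompleteSpace Y] in
/-- Unfolding `qM`. [cite: ChambollePock2015, §3 (12)] -/
theorem qM_eq [CompleteSpace X] [CompleteSpace Y] (K : X →L[ℝ] Y) (τ σ : ℝ) (d : X × Y) :
    qM K τ σ d = ⟪WithLp.toLp 2 d, metricM K τ σ (WithLp.toLp 2 d)⟫ := rfl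

/-- `M_{τ,σ}` commutes with scalars. [cite: ChambollePock2015, §3 (12)] -/
theorem metricM_smul (K : X →L[ℝ] Y) (τ σ a : ℝ) (d : WithLp 2 (X × Y)) :
    metricM K τ σ (a • d) = a • metricM K τ σ d := by
  unfold metricM
  have h1 : (a • WithLp.toLp 2 (τ⁻¹ • d.fst - K.adjoint d.snd, σ⁻¹ • d.snd - K d.fst) :
      WithLp 2 (X × Y)) =
      WithLp.toLp 2 (a • (τ⁻¹ • d.fst - K.adjoint d.snd), a • (σ⁻¹ • d.snd - K d.fst)) := rfl
  rw [h1, WithLp.smul_fst, WithLp.smul_snd, map_smul, map_smul]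
  congr 1
  ext
  · simp only
    module
  · simp only
    module

/-- `M_{τ,σ}` is additive. [cite: ChambollePock2015, §3 (12)] -/
theorem metricM_add (K : X →L[ℝ] Y) (τ σ : ℝ) (d d' : WithLp 2 (X × Y)) :
    metricM K τ σ (d + d') = metricM K τ σ d + metricM K τ σ d' := by
  have h := metricM_sub K τ σ (d + d') d'
  rw [add_sub_cancel_right] at h
  rw [h, sub_add_cancel]

/-- Symmetry of `⟨·, ·⟩_M`. [cite: ChambollePock2015, §3 (12)] -/
theorem bM_comm (K : X →L[ℝ] Y) (τ σ : ℝ) (u v : X × Y) : bM K τ σ u v = bM K τ σ v u := by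
  unfold bM
  rw [inner_metricM_comm, real_inner_comm]

/-- `⟨·, ·⟩_M` is additive in the second slot. [cite: ChambollePock2015, §3 (12)] -/
theorem bM_add_right (K : X →L[ℝ] Y) (τ σ : ℝ) (u v w : X × Y) :
    bM K τ σ u (v + w) = bM K τ σ u v + bM K τ σ u w := by
  unfold bM
  rw [WithLp.toLp_add, metricM_add, inner_add_right]

/-- `⟨·, ·⟩_M` is homogeneous in the second slot. [cite: ChambollePock2015, §3 (12)] -/
theorem bM_smul_right (K : X →L[ℝ] Y) (τ σ a : ℝ) (u v : X × Y) :
    bM K τ σ u (a • v) = a * bM K τ σ u v := by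
  unfold bM
  rw [WithLp.toLp_smul, metricM_smul, inner_smul_right]

/-- The polarization expansion `‖u + s v‖²_M = ‖u‖²_M + 2s⟨u, v⟩_M + s²‖v‖²_M`.
[cite: ChambollePock2015, §3 (12)] -/
theorem qM_add_smul (K : X →L[ℝ] Y) (τ σ : ℝ) (u v : X × Y) (s : ℝ) :
    qM K τ σ (u + s • v) = qM K τ σ u + 2 * s * bM K τ σ u v + s ^ 2 * qM K τ σ v := by
  unfold qM
  rw [bM_add_right, bM_comm K τ σ (u + s • v) u, bM_comm K τ σ (u + s • v) (s • v), bM_add_right,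
    bM_add_right, bM_smul_right, bM_smul_right, bM_comm K τ σ (s • v) u, bM_smul_right,
    bM_comm K τ σ (s • v) v, bM_smul_right]
  ring

/-- `‖u + v‖²_M = ‖u‖²_M + 2⟨u, v⟩_M + ‖v‖²_M`. [cite: ChambollePock2015, §3 (12)] -/
theorem qM_add (K : X →L[ℝ] Y) (τ σ : ℝ) (u v : X × Y) :
    qM K τ σ (u + v) = qM K τ σ u + 2 * bM K τ σ u v + qM K τ σ v := by
  have h := qM_add_smul K τ σ u v 1
  rw [one_smul] at h
  rw [h]; ring

/-- `‖a • d‖²_M = a² ‖d‖²_M`. [cite: ChambollePock2015, §3 (12)] -/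
theorem qM_smul (K : X →L[ℝ] Y) (τ σ a : ℝ) (d : X × Y) :
    qM K τ σ (a • d) = a ^ 2 * qM K τ σ d := by
  have h := qM_add_smul K τ σ 0 d a
  rw [zero_add] at h
  rw [h]
  unfold qM bM
  simp

/-- `M ⪰ 0` for `τσ‖K‖² ≤ 1`: `‖d‖²_M ≥ 0`. [cite: ChambollePock2015, §3 (after (12))]
[cite: ApplegateEtAl2022, Proposition 1 (PDHG, 0 < η ≤ 1/σ_max(A))] -/
theorem qM_nonneg (K : X →L[ℝ] Y) {τ σ : ℝ} (hτ : 0 < τ) (hσ : 0 < σ) (hK : τ * σ * ‖K‖ ^ 2 ≤ 1)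
    (d : X × Y) : 0 ≤ qM K τ σ d :=
  inner_metricM_self_nonneg K hτ hσ hK _

/-- `‖d‖_M ≥ 0`. [cite: ApplegateEtAl2022, §1 (4) (semi-norm)] -/
theorem normM_nonneg (K : X →L[ℝ] Y) (τ σ : ℝ) (d : X × Y) : 0 ≤ normM K τ σ d :=
  Real.sqrt_nonneg _

/-- `‖d‖_M² = ‖d‖²_M` (for `M ⪰ 0`). [cite: ApplegateEtAl2022, Proposition 1 (PDHG)] -/
theorem normM_sq (K : X →L[ℝ] Y) {τ σ : ℝ} (hτ : 0 < τ) (hσ : 0 < σ) (hK : τ * σ * ‖K‖ ^ 2 ≤ 1)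
    (d : X × Y) : normM K τ σ d ^ 2 = qM K τ σ d :=
  Real.sq_sqrt (qM_nonneg K hτ hσ hK d)

/-- `‖0‖_M = 0`. [cite: ApplegateEtAl2022, §1 (4) (semi-norm)] -/
theorem normM_zero (K : X →L[ℝ] Y) (τ σ : ℝ) : normM K τ σ (0 : X × Y) = 0 := by
  unfold normM qM bM
  simp

/-- Absolute homogeneity `‖a • d‖_M = |a| ‖d‖_M`. [cite: ApplegateEtAl2022, §1 (4) (semi-norm)] -/
theorem normM_smul (K : X →L[ℝ] Y) (τ σ a : ℝ) (d : X × Y) :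
    normM K τ σ (a • d) = |a| * normM K τ σ d := by
  unfold normM
  rw [qM_smul, Real.sqrt_mul (sq_nonneg a), Real.sqrt_sq_eq_abs]

/-- `‖−d‖_M = ‖d‖_M`. [cite: ApplegateEtAl2022, §1 (4) (semi-norm)] -/
theorem normM_neg (K : X →L[ℝ] Y) (τ σ : ℝ) (d : X × Y) : normM K τ σ (-d) = normM K τ σ d := by
  rw [← neg_one_smul ℝ d, normM_smul]
  simp

/-- `‖u − v‖_M = ‖v − u‖_M`. [cite: ApplegateEtAl2022, §1 (4) (semi-norm)] -/
theorem normM_sub_rev (K : X →L[ℝ] Y) (τ σ : ℝ) (u v : X × Y) :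
    normM K τ σ (u - v) = normM K τ σ (v - u) := by
  rw [← neg_sub, normM_neg]

/-- **Cauchy–Schwarz for the semidefinite form**: `⟨u, v⟩_M² ≤ ‖u‖²_M ‖v‖²_M` when `M ⪰ 0`
(discriminant of `s ↦ ‖u + s v‖²_M ≥ 0`). [folklore: Cauchy–Schwarz for a positive semidefinite form]
[cite: ApplegateEtAl2022, §1 (4) (‖·‖ is a semi-norm)] -/
theorem bM_sq_le (K : X →L[ℝ] Y) {τ σ : ℝ} (hτ : 0 < τ) (hσ : 0 < σ) (hK : τ * σ * ‖K‖ ^ 2 ≤ 1)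
    (u v : X × Y) : bM K τ σ u v ^ 2 ≤ qM K τ σ u * qM K τ σ v := by
  have h : ∀ s : ℝ, 0 ≤ qM K τ σ v * (s * s) + 2 * bM K τ σ u v * s + qM K τ σ u := by
    intro s
    have h1 := qM_nonneg K hτ hσ hK (u + s • v)
    rw [qM_add_smul] at h1
    nlinarith [h1]
  have hd := discrim_le_zero h
  unfold discrim at hd
  nlinarith [hd]

/-- `⟨u, v⟩_M ≤ ‖u‖_M ‖v‖_M`. [folklore: Cauchy–Schwarz for a positive semidefinite form]
[cite: ApplegateEtAl2022, §1 (4) (‖·‖ is a semi-norm)] -/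
theorem bM_le_normM_mul (K : X →L[ℝ] Y) {τ σ : ℝ} (hτ : 0 < τ) (hσ : 0 < σ)
    (hK : τ * σ * ‖K‖ ^ 2 ≤ 1) (u v : X × Y) :
    bM K τ σ u v ≤ normM K τ σ u * normM K τ σ v := by
  have h1 : |bM K τ σ u v| ≤ Real.sqrt (qM K τ σ u * qM K τ σ v) :=
    Real.abs_le_sqrt (bM_sq_le K hτ hσ hK u v)
  rw [Real.sqrt_mul (qM_nonneg K hτ hσ hK u)] at h1
  exact (le_abs_self _).trans h1

/-- **Triangle inequality** `‖u + v‖_M ≤ ‖u‖_M + ‖v‖_M` — `‖·‖_M` is a semi-norm.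
[cite: ApplegateEtAl2022, §1 (4) (‖·‖ is a semi-norm) and Proposition 1 (PDHG)] -/
theorem normM_add_le (K : X →L[ℝ] Y) {τ σ : ℝ} (hτ : 0 < τ) (hσ : 0 < σ)
    (hK : τ * σ * ‖K‖ ^ 2 ≤ 1) (u v : X × Y) :
    normM K τ σ (u + v) ≤ normM K τ σ u + normM K τ σ v := by
  have hu := normM_nonneg K τ σ u
  have hv := normM_nonneg K τ σ v
  unfold normM
  rw [Real.sqrt_le_left (by positivity), qM_add]
  have hcs := bM_le_normM_mul K hτ hσ hK u v
  unfold normM at hcs hu hv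
  have e1 : Real.sqrt (qM K τ σ u) ^ 2 = qM K τ σ u := Real.sq_sqrt (qM_nonneg K hτ hσ hK u)
  have e2 : Real.sqrt (qM K τ σ v) ^ 2 = qM K τ σ v := Real.sq_sqrt (qM_nonneg K hτ hσ hK v)
  nlinarith [hcs, e1, e2, hu, hv]

/-- Triangle inequality in difference form: `‖u − w‖_M ≤ ‖u − v‖_M + ‖v − w‖_M`.
[cite: ApplegateEtAl2022, §1 (4) (‖·‖ is a semi-norm)] -/
theorem normM_sub_le (K : X →L[ℝ] Y) {τ σ : ℝ} (hτ : 0 < τ) (hσ : 0 < σ)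
    (hK : τ * σ * ‖K‖ ^ 2 ≤ 1) (u v w : X × Y) :
    normM K τ σ (u - w) ≤ normM K τ σ (u - v) + normM K τ σ (v - w) := by
  have h := normM_add_le K hτ hσ hK (u - v) (v - w)
  rwa [sub_add_sub_cancel] at h

/-- `‖Σ_i f i‖_M ≤ Σ_i ‖f i‖_M`. [cite: ApplegateEtAl2022, Proposition 4 (proof, last display)] -/
theorem normM_sum_le (K : X →L[ℝ] Y) {τ σ : ℝ} (hτ : 0 < τ) (hσ : 0 < σ)
    (hK : τ * σ * ‖K‖ ^ 2 ≤ 1) (s : Finset ℕ) (f : ℕ → X × Y) :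
    normM K τ σ (∑ i ∈ s, f i) ≤ ∑ i ∈ s, normM K τ σ (f i) := by
  induction s using Finset.induction_on with
  | empty => simp [normM_zero]
  | insert a s ha ih =>
      rw [Finset.sum_insert ha, Finset.sum_insert ha]
      exact (normM_add_le K hτ hσ hK _ _).trans (by linarith)

/-- **`‖·‖_M` is a norm as soon as `τσ‖K‖² < 1`**, quantitatively:
`(1 − √(τσ)‖K‖) (‖d_x‖²/τ + ‖d_y‖²/σ) ≤ ‖d‖_M²` — so every `‖·‖_M`-estimate below is a Euclidean
estimate up to this constant. [cite: ChambollePock2015, §3 (after (12): "positive-definite as soon as τσL² < 1")]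
[cite: ApplegateEtAl2022, §1 ("if ‖·‖ is a norm, then the normalized duality gap is always finite")] -/
theorem euclidean_le_normM_sq (K : X →L[ℝ] Y) {τ σ : ℝ} (hτ : 0 < τ) (hσ : 0 < σ)
    (hK : τ * σ * ‖K‖ ^ 2 ≤ 1) (d : X × Y) :
    (1 - Real.sqrt (τ * σ) * ‖K‖) * (τ⁻¹ * ‖d.1‖ ^ 2 + σ⁻¹ * ‖d.2‖ ^ 2) ≤ normM K τ σ d ^ 2 := by
  rw [normM_sq K hτ hσ hK]
  exact inner_metricM_self_ge K hτ hσ (WithLp.toLp 2 d)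

/-- For `τσ‖K‖² < 1`, `‖d‖_M = 0` forces `d = 0`. [cite: ChambollePock2015, §3 (after (12))] -/
theorem eq_zero_of_normM_eq_zero (K : X →L[ℝ] Y) {τ σ : ℝ} (hτ : 0 < τ) (hσ : 0 < σ)
    (hK : τ * σ * ‖K‖ ^ 2 < 1) {d : X × Y} (hd : normM K τ σ d = 0) : d = 0 := by
  by_contra hne
  have hne' : (WithLp.toLp 2 d : WithLp 2 (X × Y)) ≠ 0 := by
    intro h
    apply hne
    have : WithLp.ofLp (WithLp.toLp 2 d) = WithLp.ofLp (0 : WithLp 2 (X × Y)) := by rw [h]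
    simpa using this
  have hpos := inner_metricM_self_pos K hτ hσ hK hne'
  have hq : qM K τ σ d = 0 := by
    have h := normM_sq K hτ hσ hK.le d
    rw [hd] at h
    simpa using h.symm
  rw [qM_eq] at hq
  linarith

/-! ### The solution set, feasibility and Fejér non-expansiveness of the PDHG iterates
([ApplegateEtAl2022, Proposition 2 (i)]) -/

/-- **The solution set `Z*`** of the constrained bilinear saddle `min_{x∈C} max_{y∈D} ⟨c,x⟩ + ⟨Kx,y⟩ − ⟨b,y⟩`:
its saddle points, i.e. the zeros of the conic KKT operator `(c + N_C + K*·) × (b + N_D − K·)`, as a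
subset of `X × Y`. [cite: ApplegateEtAl2022, §2 ((3) and "Z* the set of saddle points")]
[cite: ChambollePock2010, §2 (2)] -/
def saddleSet (K : X →L[ℝ] Y) (C : Set X) (D : Set Y) (c : X) (b : Y) : Set (X × Y) :=
  {z | WithLp.toLp 2 z ∈ zer (kkt K (shiftOp c (normalCone C)) (shiftOp b (normalCone D)))}

/-- Membership in `Z*` is the pair of saddle inequalities on `C × D`.
[cite: ApplegateEtAl2022, §2 (saddle points of (3))] [cite: ChambollePock2010, §2 (2)] -/
theorem mem_saddleSet_iff (K : X →L[ℝ] Y) (C : Set X) (D : Set Y) (c : X) (b : Y) (z : X × Y) :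
    z ∈ saddleSet K C D c b ↔
      z.1 ∈ C ∧ z.2 ∈ D ∧ (∀ x ∈ C, conicL K c b z.1 z.2 ≤ conicL K c b x z.2) ∧
        ∀ y ∈ D, conicL K c b z.1 y ≤ conicL K c b z.1 z.2 :=
  mem_zer_kkt_conic_iff_saddle K C D c b z.1 z.2

omit [CompleteSpace X] in
/-- A resolvent map of `c + N_C` takes values in `C` (the normal cone is empty off `C`).
[cite: ChambollePock2010, §2 (resolvent of the indicator = projection onto C)] -/
theorem resolventMap_mem [CompleteSpace X] {C : Set X} {c : X} {τ : ℝ} {jA : X → X}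
    (hjA : IsResolventMap τ (shiftOp c (normalCone C)) jA) (u : X) : jA u ∈ C := by
  obtain ⟨w, hw, -⟩ := (mem_resolvent_iff).mp (hjA u)
  exact (mem_normalCone_iff.mp (mem_shiftOp_iff.mp hw)).1

/-- The PDHG iterates `z^n`, `n ≥ 1`, of the conic saddle are feasible: `x^n ∈ C`.
[cite: ApplegateEtAl2022, §2 (PDHG update (z̃ = z ∈ Z))] -/
theorem pdhgIter_fst_mem [FiniteDimensional ℝ X] [FiniteDimensional ℝ Y] (K : X →L[ℝ] Y)
    {C : Set X} {D : Set Y} {c : X} {b : Y} {τ σ : ℝ} {jA : X → X} {jB : Y → Y}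
    (hjA : IsResolventMap τ (shiftOp c (normalCone C)) jA)
    (_hjB : IsResolventMap σ (shiftOp b (normalCone D)) jB) (z₀ : X × Y) (n : ℕ) :
    (pdhgIter K τ σ jA jB z₀ (n + 1)).1 ∈ C :=
  resolventMap_mem hjA _

/-- The PDHG iterates `z^n`, `n ≥ 1`, of the conic saddle are feasible: `y^n ∈ D`.
[cite: ApplegateEtAl2022, §2 (PDHG update (z̃ = z ∈ Z))] -/
theorem pdhgIter_snd_mem [FiniteDimensional ℝ X] [FiniteDimensional ℝ Y] (K : X →L[ℝ] Y)
    {C : Set X} {D : Set Y} {c : X} {b : Y} {τ σ : ℝ} {jA : X → X} {jB : Y → Y}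
    (_hjA : IsResolventMap τ (shiftOp c (normalCone C)) jA)
    (hjB : IsResolventMap σ (shiftOp b (normalCone D)) jB) (z₀ : X × Y) (n : ℕ) :
    (pdhgIter K τ σ jA jB z₀ (n + 1)).2 ∈ D :=
  resolventMap_mem hjB _

/-- **Fejér non-expansiveness of one PDHG step in `‖·‖_M`** ([ApplegateEtAl2022, Prop. 2 (i)] for
PDHG): for monotone `A`, `B` with resolvent maps `jA = J_{τA}`, `jB = J_{σB}`, `τ, σ > 0`,
`τσ‖K‖² ≤ 1`, and any zero `z*` of the KKT operator, `‖z⁺ − z*‖_M ≤ ‖z − z*‖_M`.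
(From the tree's squared Fejér inequality `fejer_step`.) [cite: ApplegateEtAl2022, Proposition 2 (i)]
[cite: ChambollePock2010, Theorem 1 (a)] -/
theorem normM_pdhgStep_sub_le (K : X →L[ℝ] Y) {A : Set (X × X)} {B : Set (Y × Y)} {τ σ : ℝ}
    (hτ : 0 < τ) (hσ : 0 < σ) (hK : τ * σ * ‖K‖ ^ 2 ≤ 1) (hA : IsMonotone A) (hB : IsMonotone B)
    {jA : X → X} {jB : Y → Y} (hjA : IsResolventMap τ A jA) (hjB : IsResolventMap σ B jB)
    {zs : X × Y} (hzs : WithLp.toLp 2 zs ∈ zer (kkt K A B)) (u : X × Y) :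
    normM K τ σ (pdhgStep K τ σ jA jB u - zs) ≤ normM K τ σ (u - zs) := by
  have h := fejer_step K hτ hσ hA hB hjA hjB hzs u
  have hnn := inner_metricM_self_nonneg K hτ hσ hK
    (WithLp.toLp 2 u - WithLp.toLp 2 (pdhgStep K τ σ jA jB u))
  unfold normM
  refine Real.sqrt_le_sqrt ?_
  rw [qM_eq, qM_eq, WithLp.toLp_sub, WithLp.toLp_sub]
  linarith

/-- Iterated: `‖z^n − z*‖_M ≤ ‖z⁰ − z*‖_M` for every `n` ("`z^t` stays in a bounded region").
[cite: ApplegateEtAl2022, Proposition 2 (i) and the remark after it] -/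
theorem normM_pdhgIter_sub_le [FiniteDimensional ℝ X] [FiniteDimensional ℝ Y] (K : X →L[ℝ] Y)
    {A : Set (X × X)} {B : Set (Y × Y)} {τ σ : ℝ} (hτ : 0 < τ) (hσ : 0 < σ)
    (hK : τ * σ * ‖K‖ ^ 2 ≤ 1) (hA : IsMonotone A) (hB : IsMonotone B) {jA : X → X} {jB : Y → Y}
    (hjA : IsResolventMap τ A jA) (hjB : IsResolventMap σ B jB) {zs : X × Y}
    (hzs : WithLp.toLp 2 zs ∈ zer (kkt K A B)) (z₀ : X × Y) (n : ℕ) :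
    normM K τ σ (pdhgIter K τ σ jA jB z₀ n - zs) ≤ normM K τ σ (z₀ - zs) := by
  induction n with
  | zero => exact le_rfl
  | succ n ih =>
      exact (normM_pdhgStep_sub_le K hτ hσ hK hA hB hjA hjB hzs _).trans ih

/-! ### The averaged output, the gap function and the ergodic rate in `‖·‖_M`
([ApplegateEtAl2022, Proposition 2 (ii)] for PDHG) -/

/-- **The restart map of PDHG**: run `t` PDHG steps from `z⁰` and output the average
`z̄^t = (X_t, Y_t) = t⁻¹ Σ_{i=1}^t z^i` (for PDHG the "target" iterates are the iterates, `z̃^t = z^t`).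
[cite: ApplegateEtAl2022, Proposition 4 (z̄_t = t⁻¹ Σ z̃_i) and §4 Algorithm 1] -/
noncomputable def avgPDHG [FiniteDimensional ℝ X] [FiniteDimensional ℝ Y] (K : X →L[ℝ] Y)
    (τ σ : ℝ) (jA : X → X) (jB : Y → Y) (t : ℕ) (z₀ : X × Y) : X × Y :=
  (xAvg (pdhgIter K τ σ jA jB z₀) t, yAvg (pdhgIter K τ σ jA jB z₀) t)

/-- **The primal–dual gap function** of the conic saddle at `z = (x, y)` against `ζ = (ξ, η)`:
`G(z; ζ) = L(x, η) − L(ξ, y)` (its supremum over `ζ ∈ W_r(z)`, divided by `r`, is the normalized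
duality gap). [cite: ApplegateEtAl2022, §1 (4) (the bracket L(x, ŷ) − L(x̂, y))] -/
noncomputable def gap (K : X →L[ℝ] Y) (c : X) (b : Y) (z ζ : X × Y) : ℝ :=
  conicL K c b z.1 ζ.2 - conicL K c b ζ.1 z.2

omit [CompleteSpace X] [CompleteSpace Y] in
/-- `G(z; z) = 0`. [cite: ApplegateEtAl2022, §1 (4)] -/
theorem gap_self [CompleteSpace X] [CompleteSpace Y] (K : X →L[ℝ] Y) (c : X) (b : Y) (z : X × Y) :
    gap K c b z z = 0 := sub_self _

/-- The averaged output is feasible: `X_t ∈ C` for `t ≥ 1` (convexity of `C`).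
[cite: ApplegateEtAl2022, Property 3 ("z̄^t ∈ Z")] -/
theorem avgPDHG_fst_mem [FiniteDimensional ℝ X] [FiniteDimensional ℝ Y] (K : X →L[ℝ] Y)
    {C : Set X} (hC : Convex ℝ C) {D : Set Y} {c : X} {b : Y} {τ σ : ℝ} {jA : X → X} {jB : Y → Y}
    (hjA : IsResolventMap τ (shiftOp c (normalCone C)) jA)
    (hjB : IsResolventMap σ (shiftOp b (normalCone D)) jB) (z₀ : X × Y) {t : ℕ} (ht : t ≠ 0) :
    (avgPDHG K τ σ jA jB t z₀).1 ∈ C := by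
  unfold avgPDHG xAvg
  simp only
  rw [Finset.smul_sum]
  refine hC.sum_mem (fun _ _ => by positivity) ?_
    (fun n _ => pdhgIter_fst_mem K hjA hjB z₀ n)
  rw [Finset.sum_const, Finset.card_range, nsmul_eq_mul, mul_inv_cancel₀ (Nat.cast_ne_zero.mpr ht)]

/-- The averaged output is feasible: `Y_t ∈ D` for `t ≥ 1` (convexity of `D`).
[cite: ApplegateEtAl2022, Property 3 ("z̄^t ∈ Z")] -/
theorem avgPDHG_snd_mem [FiniteDimensional ℝ X] [FiniteDimensional ℝ Y] (K : X →L[ℝ] Y)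
    {C : Set X} {D : Set Y} (hD : Convex ℝ D) {c : X} {b : Y} {τ σ : ℝ} {jA : X → X} {jB : Y → Y}
    (hjA : IsResolventMap τ (shiftOp c (normalCone C)) jA)
    (hjB : IsResolventMap σ (shiftOp b (normalCone D)) jB) (z₀ : X × Y) {t : ℕ} (ht : t ≠ 0) :
    (avgPDHG K τ σ jA jB t z₀).2 ∈ D := by
  unfold avgPDHG yAvg
  simp only
  rw [Finset.smul_sum]
  refine hD.sum_mem (fun _ _ => by positivity) ?_
    (fun n _ => pdhgIter_snd_mem K hjA hjB z₀ n)
  rw [Finset.sum_const, Finset.card_range, nsmul_eq_mul, mul_inv_cancel₀ (Nat.cast_ne_zero.mpr ht)]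

/-- **The ergodic `O(1/t)` gap bound in `‖·‖_M` form** ([ApplegateEtAl2022, Prop. 2 (ii)] for PDHG,
`C = 1` in the `M_{τ,σ}`-seminorm; = [ChambollePock2015, Thm 1]): for `τ, σ > 0`, `τσ‖K‖² ≤ 1`,
every feasible `ζ ∈ C × D` and `t ≥ 1`, `G(z̄^t; ζ) ≤ ‖ζ − z⁰‖_M² / (2t)`.
[cite: ApplegateEtAl2022, Proposition 2 (ii)] [cite: ChambollePock2015, Theorem 1 ((13)–(14), f = 0)] -/
theorem gap_avgPDHG_le [FiniteDimensional ℝ X] [FiniteDimensional ℝ Y] (K : X →L[ℝ] Y)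
    {C : Set X} {D : Set Y} (c : X) (b : Y) {τ σ : ℝ} (hτ : 0 < τ) (hσ : 0 < σ)
    (hK : τ * σ * ‖K‖ ^ 2 ≤ 1) {jA : X → X} {jB : Y → Y}
    (hjA : IsResolventMap τ (shiftOp c (normalCone C)) jA)
    (hjB : IsResolventMap σ (shiftOp b (normalCone D)) jB) (z₀ : X × Y) {ζ : X × Y} (hζ1 : ζ.1 ∈ C)
    (hζ2 : ζ.2 ∈ D) {t : ℕ} (ht : t ≠ 0) :
    gap K c b (avgPDHG K τ σ jA jB t z₀) ζ ≤ normM K τ σ (ζ - z₀) ^ 2 / (2 * t) := by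
  have h := conicL_gap_ergodic_le K c b hτ hσ hK hjA hjB z₀ hζ1 hζ2 ht
  rw [normM_sub_rev, normM_sq K hτ hσ hK, qM_eq, WithLp.toLp_sub]
  unfold gap avgPDHG
  simp only
  have ht' : (0 : ℝ) < t := Nat.cast_pos.mpr (Nat.pos_of_ne_zero ht)
  calc conicL K c b (xAvg (pdhgIter K τ σ jA jB z₀) t) ζ.2 -
        conicL K c b ζ.1 (yAvg (pdhgIter K τ σ jA jB z₀) t) ≤
        (t : ℝ)⁻¹ * (2⁻¹ * ⟪WithLp.toLp 2 z₀ - WithLp.toLp 2 (ζ.1, ζ.2),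
          metricM K τ σ (WithLp.toLp 2 z₀ - WithLp.toLp 2 (ζ.1, ζ.2))⟫) := h
    _ = ⟪WithLp.toLp 2 z₀ - WithLp.toLp 2 ζ, metricM K τ σ (WithLp.toLp 2 z₀ - WithLp.toLp 2 ζ)⟫ /
          (2 * t) := by
        rw [Prod.mk.eta]
        field_simp

/-! ### Property 3 for PDHG ([ApplegateEtAl2022, Proposition 4] with `C = 1`, `q = 0`) -/

/-- Averages minus a constant: `t⁻¹ Σ_{i<t} f i − v = t⁻¹ Σ_{i<t} (f i − v)` (`t ≥ 1`).
[folklore: linear algebra of averages] -/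
private theorem avg_sub_const {V : Type*} [AddCommGroup V] [Module ℝ V] (f : ℕ → V) (v : V)
    {t : ℕ} (ht : t ≠ 0) :
    (t : ℝ)⁻¹ • ∑ i ∈ Finset.range t, f i - v = (t : ℝ)⁻¹ • ∑ i ∈ Finset.range t, (f i - v) := by
  have ht' : (t : ℝ) ≠ 0 := Nat.cast_ne_zero.mpr ht
  rw [Finset.sum_sub_distrib, Finset.sum_const, Finset.card_range, smul_sub,
    ← Nat.cast_smul_eq_nsmul ℝ, smul_smul, inv_mul_cancel₀ ht', one_smul]

/-- The displacement of the averaged output is the average of the displacements: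
`z̄^t − z⁰ = t⁻¹ Σ_{i=1}^t (z^i − z⁰)`. [cite: ApplegateEtAl2022, Proposition 4 (proof, last display)] -/
theorem avgPDHG_sub_eq [FiniteDimensional ℝ X] [FiniteDimensional ℝ Y] (K : X →L[ℝ] Y) (τ σ : ℝ)
    (jA : X → X) (jB : Y → Y) {t : ℕ} (ht : t ≠ 0) (z₀ : X × Y) :
    avgPDHG K τ σ jA jB t z₀ - z₀ =
      (t : ℝ)⁻¹ • ∑ i ∈ Finset.range t, (pdhgIter K τ σ jA jB z₀ (i + 1) - z₀) := by
  unfold avgPDHG xAvg yAvg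
  ext
  · simp only [Prod.fst_sub, Prod.smul_fst, Prod.fst_sum]
    exact avg_sub_const _ _ ht
  · simp only [Prod.snd_sub, Prod.smul_snd, Prod.snd_sum]
    exact avg_sub_const _ _ ht

/-- **Property 3 (b) for PDHG, pointwise form: `‖z̄^t − z⁰‖_M ≤ 2 ‖z⁰ − z*‖_M`** for every saddle
point `z*` (`q = 0` for PDHG: triangle inequality through `z*`, non-expansiveness, and convexity of the
semi-norm under averaging). [cite: ApplegateEtAl2022, Proposition 4 (Property 3 (ii), q = 0 by Proposition 3)] -/
theorem normM_avgPDHG_sub_le [FiniteDimensional ℝ X] [FiniteDimensional ℝ Y] (K : X →L[ℝ] Y)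
    {A : Set (X × X)} {B : Set (Y × Y)} {τ σ : ℝ} (hτ : 0 < τ) (hσ : 0 < σ)
    (hK : τ * σ * ‖K‖ ^ 2 ≤ 1) (hA : IsMonotone A) (hB : IsMonotone B) {jA : X → X} {jB : Y → Y}
    (hjA : IsResolventMap τ A jA) (hjB : IsResolventMap σ B jB) {zs : X × Y}
    (hzs : WithLp.toLp 2 zs ∈ zer (kkt K A B)) (z₀ : X × Y) {t : ℕ} (ht : t ≠ 0) :
    normM K τ σ (avgPDHG K τ σ jA jB t z₀ - z₀) ≤ 2 * normM K τ σ (z₀ - zs) := by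
  have ht' : (0 : ℝ) < t := Nat.cast_pos.mpr (Nat.pos_of_ne_zero ht)
  rw [avgPDHG_sub_eq K τ σ jA jB ht, normM_smul, abs_of_pos (inv_pos.mpr ht')]
  have hterm : ∀ i ∈ Finset.range t,
      normM K τ σ (pdhgIter K τ σ jA jB z₀ (i + 1) - z₀) ≤ 2 * normM K τ σ (z₀ - zs) := by
    intro i _
    calc normM K τ σ (pdhgIter K τ σ jA jB z₀ (i + 1) - z₀)
        ≤ normM K τ σ (pdhgIter K τ σ jA jB z₀ (i + 1) - zs) + normM K τ σ (zs - z₀) :=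
          normM_sub_le K hτ hσ hK _ _ _
      _ ≤ normM K τ σ (z₀ - zs) + normM K τ σ (z₀ - zs) := by
          rw [normM_sub_rev K τ σ zs z₀]
          exact add_le_add (normM_pdhgIter_sub_le K hτ hσ hK hA hB hjA hjB hzs z₀ _) le_rfl
      _ = 2 * normM K τ σ (z₀ - zs) := by ring
  calc (t : ℝ)⁻¹ * normM K τ σ (∑ i ∈ Finset.range t, (pdhgIter K τ σ jA jB z₀ (i + 1) - z₀))
      ≤ (t : ℝ)⁻¹ * ∑ i ∈ Finset.range t, normM K τ σ (pdhgIter K τ σ jA jB z₀ (i + 1) - z₀) :=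
        mul_le_mul_of_nonneg_left (normM_sum_le K hτ hσ hK _ _) (inv_nonneg.mpr ht'.le)
    _ ≤ (t : ℝ)⁻¹ * ∑ _i ∈ Finset.range t, 2 * normM K τ σ (z₀ - zs) :=
        mul_le_mul_of_nonneg_left (Finset.sum_le_sum hterm) (inv_nonneg.mpr ht'.le)
    _ = 2 * normM K τ σ (z₀ - zs) := by
        rw [Finset.sum_const, Finset.card_range, nsmul_eq_mul]
        field_simp

/-- **Property 3 (a) for PDHG, pointwise form.** With `r = ‖z̄^t − z⁰‖_M`: for every feasible
`ζ ∈ C × D` within `‖ζ − z̄^t‖_M ≤ ρ` one has `G(z̄^t; ζ) ≤ (ρ + r)²/(2t)` — the ball `W_ρ(z̄^t)` sits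
inside `W_{ρ+r}(z⁰)` and the ergodic bound applies there. (The printed case is `ρ = r`:
`G ≤ (2r)²/(2t)`, i.e. `ρ_r(z̄^t) ≤ 2Cr/t` with `C = 1`.) [cite: ApplegateEtAl2022, Proposition 4 (proof, first display)] -/
theorem gap_avgPDHG_le_of_normM_le [FiniteDimensional ℝ X] [FiniteDimensional ℝ Y]
    (K : X →L[ℝ] Y) {C : Set X} {D : Set Y} (c : X) (b : Y) {τ σ : ℝ} (hτ : 0 < τ) (hσ : 0 < σ)
    (hK : τ * σ * ‖K‖ ^ 2 ≤ 1) {jA : X → X} {jB : Y → Y}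
    (hjA : IsResolventMap τ (shiftOp c (normalCone C)) jA)
    (hjB : IsResolventMap σ (shiftOp b (normalCone D)) jB) (z₀ : X × Y) {t : ℕ} (ht : t ≠ 0)
    {ζ : X × Y} (hζ1 : ζ.1 ∈ C) (hζ2 : ζ.2 ∈ D) {ρ : ℝ}
    (hζ : normM K τ σ (ζ - avgPDHG K τ σ jA jB t z₀) ≤ ρ) :
    gap K c b (avgPDHG K τ σ jA jB t z₀) ζ ≤
      (ρ + normM K τ σ (avgPDHG K τ σ jA jB t z₀ - z₀)) ^ 2 / (2 * t) := by
  have ht' : (0 : ℝ) < t := Nat.cast_pos.mpr (Nat.pos_of_ne_zero ht)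
  have h1 := gap_avgPDHG_le K c b hτ hσ hK hjA hjB z₀ hζ1 hζ2 ht
  have h2 : normM K τ σ (ζ - z₀) ≤ ρ + normM K τ σ (avgPDHG K τ σ jA jB t z₀ - z₀) :=
    (normM_sub_le K hτ hσ hK ζ (avgPDHG K τ σ jA jB t z₀) z₀).trans (add_le_add hζ le_rfl)
  have h0 : 0 ≤ normM K τ σ (ζ - z₀) := normM_nonneg K τ σ _
  have h3 : normM K τ σ (ζ - z₀) ^ 2 ≤ (ρ + normM K τ σ (avgPDHG K τ σ jA jB t z₀ - z₀)) ^ 2 :=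
    pow_le_pow_left₀ h0 h2 2
  exact h1.trans (div_le_div_of_nonneg_right h3 (by positivity))

/-- **Property 3 (a) for PDHG at the natural radius**: with `r = ‖z̄^t − z⁰‖_M`, every feasible `ζ`
with `‖ζ − z̄^t‖_M ≤ r` has `G(z̄^t; ζ) ≤ 2r²/t` (so `ρ_r(z̄^t) ≤ 2r/t`: Property 3 (i) with `C = 1`).
[cite: ApplegateEtAl2022, Proposition 4 (Property 3 (i))] -/
theorem gap_avgPDHG_le_two_mul_sq [FiniteDimensional ℝ X] [FiniteDimensional ℝ Y]
    (K : X →L[ℝ] Y) {C : Set X} {D : Set Y} (c : X) (b : Y) {τ σ : ℝ} (hτ : 0 < τ) (hσ : 0 < σ)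
    (hK : τ * σ * ‖K‖ ^ 2 ≤ 1) {jA : X → X} {jB : Y → Y}
    (hjA : IsResolventMap τ (shiftOp c (normalCone C)) jA)
    (hjB : IsResolventMap σ (shiftOp b (normalCone D)) jB) (z₀ : X × Y) {t : ℕ} (ht : t ≠ 0)
    {ζ : X × Y} (hζ1 : ζ.1 ∈ C) (hζ2 : ζ.2 ∈ D)
    (hζ : normM K τ σ (ζ - avgPDHG K τ σ jA jB t z₀) ≤
      normM K τ σ (avgPDHG K τ σ jA jB t z₀ - z₀)) :
    gap K c b (avgPDHG K τ σ jA jB t z₀) ζ ≤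
      2 * normM K τ σ (avgPDHG K τ σ jA jB t z₀ - z₀) ^ 2 / t := by
  have ht' : (0 : ℝ) < t := Nat.cast_pos.mpr (Nat.pos_of_ne_zero ht)
  have h := gap_avgPDHG_le_of_normM_le K c b hτ hσ hK hjA hjB z₀ ht hζ1 hζ2 hζ
  refine h.trans (le_of_eq ?_)
  field_simp
  ring

/-! ### The degenerate case `‖z̄^t − z⁰‖_M = 0` ([ApplegateEtAl2022, Proposition 8] for PDHG) -/

omit [CompleteSpace X] [CompleteSpace Y] in
/-- The gap is affine along segments from `z`: `G(z; z + s(ζ − z)) = s · G(z; ζ)` (bilinearity of `L`).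
[cite: ApplegateEtAl2022, Proposition 6 (proof: "convex-concavity of L" along z + α(ẑ − z))] -/
theorem gap_add_smul_sub [CompleteSpace X] [CompleteSpace Y] (K : X →L[ℝ] Y) (c : X) (b : Y)
    (z ζ : X × Y) (s : ℝ) : gap K c b z (z + s • (ζ - z)) = s * gap K c b z ζ := by
  unfold gap conicL
  simp only [Prod.fst_add, Prod.snd_add, Prod.smul_fst, Prod.smul_snd, Prod.fst_sub, Prod.snd_sub,
    inner_add_right, inner_smul_right, inner_sub_right, map_add, map_smul, map_sub, inner_add_left,
    inner_smul_left, inner_sub_left, conj_trivial]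
  ring

/-- **The degenerate restart ([ApplegateEtAl2022, Prop. 8] for PDHG): if `‖z̄^t − z⁰‖_M = 0` then
`z̄^t ∈ Z*`.** In print: Property 3 forces `ρ_0(z̄^t) = 0`, hence a zero primal–dual gap
(Proposition 6). Here directly: for feasible `ζ` and `s ∈ (0, 1]` the point `z̄ + s(ζ − z̄)` is feasible
at `‖·‖_M`-distance `s‖ζ − z̄‖_M` from `z̄`, so Property 3 (a) gives `s·G(z̄; ζ) ≤ s²‖ζ − z̄‖²_M/(2t)`;
letting `s ↓ 0`, `G(z̄; ζ) ≤ 0` for every feasible `ζ`, which is the pair of saddle inequalities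
(no definiteness of `M` is needed). [cite: ApplegateEtAl2022, Proposition 8 (with Proposition 6)] -/
theorem avgPDHG_mem_saddleSet_of_normM_eq_zero [FiniteDimensional ℝ X] [FiniteDimensional ℝ Y]
    (K : X →L[ℝ] Y) {C : Set X} {D : Set Y} (hC : Convex ℝ C) (hD : Convex ℝ D) (c : X) (b : Y)
    {τ σ : ℝ} (hτ : 0 < τ) (hσ : 0 < σ) (hK : τ * σ * ‖K‖ ^ 2 ≤ 1) {jA : X → X} {jB : Y → Y}
    (hjA : IsResolventMap τ (shiftOp c (normalCone C)) jA)
    (hjB : IsResolventMap σ (shiftOp b (normalCone D)) jB) (z₀ : X × Y) {t : ℕ} (ht : t ≠ 0)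
    (h0 : normM K τ σ (avgPDHG K τ σ jA jB t z₀ - z₀) = 0) :
    avgPDHG K τ σ jA jB t z₀ ∈ saddleSet K C D c b := by
  set zb := avgPDHG K τ σ jA jB t z₀ with hzb
  have hzb1 : zb.1 ∈ C := avgPDHG_fst_mem K hC hjA hjB z₀ ht
  have hzb2 : zb.2 ∈ D := avgPDHG_snd_mem K hD hjA hjB z₀ ht
  have ht' : (0 : ℝ) < t := Nat.cast_pos.mpr (Nat.pos_of_ne_zero ht)
  -- the gap at `z̄` is nonpositive against every feasible point
  have hgap : ∀ ζ : X × Y, ζ.1 ∈ C → ζ.2 ∈ D → gap K c b zb ζ ≤ 0 := by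
    intro ζ hζ1 hζ2
    set nz := normM K τ σ (ζ - zb) with hnz
    have hnz0 : 0 ≤ nz := normM_nonneg K τ σ _
    -- the scaled bound `G(z̄; ζ) ≤ s ‖ζ − z̄‖²_M / (2t)` for `0 < s ≤ 1`
    have hscale : ∀ s : ℝ, 0 < s → s ≤ 1 → gap K c b zb ζ ≤ s * (nz ^ 2 / (2 * t)) := by
      intro s hs0 hs1
      have hmem : zb + s • (ζ - zb) ∈ {w : X × Y | w.1 ∈ C ∧ w.2 ∈ D} := by
        constructor
        · simpa using hC.add_smul_sub_mem hzb1 hζ1 ⟨hs0.le, hs1⟩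
        · simpa using hD.add_smul_sub_mem hzb2 hζ2 ⟨hs0.le, hs1⟩
      have hdist : normM K τ σ (zb + s • (ζ - zb) - zb) ≤ s * nz := by
        rw [add_sub_cancel_left, normM_smul, abs_of_pos hs0]
      have h := gap_avgPDHG_le_of_normM_le K c b hτ hσ hK hjA hjB z₀ ht hmem.1 hmem.2 hdist
      rw [← hzb, h0, add_zero, gap_add_smul_sub] at h
      -- `s G ≤ (s nz)² / (2t)` ⇒ `G ≤ s nz²/(2t)`
      have h' : s * gap K c b zb ζ ≤ s * (s * (nz ^ 2 / (2 * t))) := by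
        refine h.trans (le_of_eq ?_)
        ring
      exact le_of_mul_le_mul_left h' hs0
    -- let `s ↓ 0`
    refine le_of_forall_pos_le_add fun ε hε => ?_
    rw [zero_add]
    by_cases hc : nz ^ 2 / (2 * t) ≤ ε
    · exact (hscale 1 one_pos le_rfl).trans (by linarith)
    · push Not at hc
      have hcpos : 0 < nz ^ 2 / (2 * t) := hε.trans hc
      have hs1 : ε / (nz ^ 2 / (2 * t)) ≤ 1 := (div_le_one hcpos).mpr hc.le
      have h := hscale (ε / (nz ^ 2 / (2 * t))) (div_pos hε hcpos) hs1
      rwa [div_mul_cancel₀ ε hcpos.ne'] at h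
  -- the saddle inequalities
  refine (mem_saddleSet_iff K C D c b zb).mpr ⟨hzb1, hzb2, fun x hx => ?_, fun y hy => ?_⟩
  · have h := hgap (x, zb.2) hx hzb2
    unfold gap at h
    simp only at h
    linarith
  · have h := hgap (zb.1, y) hzb1 hy
    unfold gap at h
    simp only at h
    linarith

/-! ### Distances, balls, diameters and the normalized duality gap in the `M`-geometry -/

/-- The `‖·‖_M`-distance to a set, `dist_M(z, S) = inf_{w ∈ S} ‖z − w‖_M`.
[cite: ApplegateEtAl2022, §1 (dist(z, Z*) := inf ‖z − ẑ‖)] -/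
noncomputable def infDistM (K : X →L[ℝ] Y) (τ σ : ℝ) (z : X × Y) (S : Set (X × Y)) : ℝ :=
  sInf ((fun w => normM K τ σ (z - w)) '' S)

/-- `dist_M(z, S) ≥ 0`. [cite: ApplegateEtAl2022, §1 (dist)] -/
theorem infDistM_nonneg (K : X →L[ℝ] Y) (τ σ : ℝ) (z : X × Y) (S : Set (X × Y)) :
    0 ≤ infDistM K τ σ z S := by
  refine Real.sInf_nonneg ?_
  rintro _ ⟨w, -, rfl⟩
  exact normM_nonneg K τ σ _

/-- `dist_M(z, S) ≤ ‖z − w‖_M` for `w ∈ S`. [cite: ApplegateEtAl2022, §1 (dist)] -/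
theorem infDistM_le (K : X →L[ℝ] Y) (τ σ : ℝ) (z : X × Y) {S : Set (X × Y)} {w : X × Y}
    (hw : w ∈ S) : infDistM K τ σ z S ≤ normM K τ σ (z - w) :=
  csInf_le ⟨0, by rintro _ ⟨v, -, rfl⟩; exact normM_nonneg K τ σ _⟩ ⟨w, hw, rfl⟩

/-- A lower bound valid against every `w ∈ S ≠ ∅` bounds `dist_M(z, S)` from below.
[cite: ApplegateEtAl2022, §1 (dist)] -/
theorem le_infDistM (K : X →L[ℝ] Y) (τ σ : ℝ) (z : X × Y) {S : Set (X × Y)} (hS : S.Nonempty)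
    {a : ℝ} (h : ∀ w ∈ S, a ≤ normM K τ σ (z - w)) : a ≤ infDistM K τ σ z S := by
  refine le_csInf (hS.image _) ?_
  rintro _ ⟨w, hw, rfl⟩
  exact h w hw

/-- `dist_M(z, S) = 0` for `z ∈ S`. [cite: ApplegateEtAl2022, §1 (dist)] -/
theorem infDistM_of_mem (K : X →L[ℝ] Y) (τ σ : ℝ) {z : X × Y} {S : Set (X × Y)} (hz : z ∈ S) :
    infDistM K τ σ z S = 0 := by
  refine le_antisymm ?_ (infDistM_nonneg K τ σ z S)
  have h := infDistM_le K τ σ z hz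
  rwa [sub_self, normM_zero] at h

/-- **The feasible `‖·‖_M`-ball `W_R(z⁰) = {z ∈ C × D : ‖z − z⁰‖_M ≤ R}`** ("the ball centered at
`z` with radius `r` intersected with the set `Z`"). [cite: ApplegateEtAl2022, §1 (4) (W_r(z))] -/
def ballM (K : X →L[ℝ] Y) (C : Set X) (D : Set Y) (τ σ : ℝ) (z₀ : X × Y) (R : ℝ) : Set (X × Y) :=
  {z | z.1 ∈ C ∧ z.2 ∈ D ∧ normM K τ σ (z - z₀) ≤ R}

omit [CompleteSpace X] [CompleteSpace Y] in
/-- Membership in `W_R(z⁰)`. [cite: ApplegateEtAl2022, §1 (4)] -/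
theorem mem_ballM_iff [CompleteSpace X] [CompleteSpace Y] (K : X →L[ℝ] Y) (C : Set X) (D : Set Y)
    (τ σ : ℝ) (z₀ : X × Y) (R : ℝ) (z : X × Y) :
    z ∈ ballM K C D τ σ z₀ R ↔ z.1 ∈ C ∧ z.2 ∈ D ∧ normM K τ σ (z - z₀) ≤ R := Iff.rfl

/-- The `‖·‖_M`-diameter of a set, `diam S = sup_{s, s' ∈ S} ‖s − s'‖_M`.
[cite: ApplegateEtAl2022, §1 Notation (diam(S) := sup ‖s − s'‖)] -/
noncomputable def diamM (K : X →L[ℝ] Y) (τ σ : ℝ) (S : Set (X × Y)) : ℝ :=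
  sSup ((fun p : (X × Y) × (X × Y) => normM K τ σ (p.1 - p.2)) '' S ×ˢ S)

/-- Two points of the ball `W_R(z⁰)` are at `‖·‖_M`-distance at most its diameter.
[cite: ApplegateEtAl2022, §1 Notation (diam)] -/
theorem normM_sub_le_diamM_ballM (K : X →L[ℝ] Y) {C : Set X} {D : Set Y} {τ σ : ℝ} (hτ : 0 < τ)
    (hσ : 0 < σ) (hK : τ * σ * ‖K‖ ^ 2 ≤ 1) (z₀ : X × Y) (R : ℝ) {u v : X × Y}
    (hu : u ∈ ballM K C D τ σ z₀ R) (hv : v ∈ ballM K C D τ σ z₀ R) :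
    normM K τ σ (u - v) ≤ diamM K τ σ (ballM K C D τ σ z₀ R) := by
  refine le_csSup ?_ ⟨(u, v), Set.mk_mem_prod hu hv, rfl⟩
  refine ⟨R + R, ?_⟩
  rintro _ ⟨p, hp, rfl⟩
  obtain ⟨hp1, hp2⟩ := Set.mem_prod.mp hp
  obtain ⟨-, -, hp1⟩ := (mem_ballM_iff K C D τ σ z₀ R _).mp hp1
  obtain ⟨-, -, hp2⟩ := (mem_ballM_iff K C D τ σ z₀ R _).mp hp2
  rw [normM_sub_rev] at hp2
  exact (normM_sub_le K hτ hσ hK p.1 z₀ p.2).trans (add_le_add hp1 hp2)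

/-- The diameter of `W_R(z⁰)` is at most `2R` (`R ≥ 0`). [cite: ApplegateEtAl2022, Lemma 5 (proof: diam(W_R(0)) ≤ 2R)] -/
theorem diamM_ballM_le (K : X →L[ℝ] Y) (C : Set X) (D : Set Y) {τ σ : ℝ} (hτ : 0 < τ) (hσ : 0 < σ)
    (hK : τ * σ * ‖K‖ ^ 2 ≤ 1) (z₀ : X × Y) {R : ℝ} (hR : 0 ≤ R) :
    diamM K τ σ (ballM K C D τ σ z₀ R) ≤ 2 * R := by
  refine Real.sSup_le ?_ (by positivity)
  rintro _ ⟨p, hp, rfl⟩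
  obtain ⟨hp1, hp2⟩ := Set.mem_prod.mp hp
  obtain ⟨-, -, hp1⟩ := (mem_ballM_iff K C D τ σ z₀ R _).mp hp1
  obtain ⟨-, -, hp2⟩ := (mem_ballM_iff K C D τ σ z₀ R _).mp hp2
  rw [normM_sub_rev] at hp2
  linarith [normM_sub_le K hτ hσ hK p.1 z₀ p.2]

/-- **The normalized duality gap of the conic saddle in the `M`-geometry**,
`ρ_r(z) = r⁻¹ · sup {L(x, η) − L(ξ, y) : (ξ, η) ∈ C × D, ‖(ξ, η) − z‖_M ≤ r}`.
(For `r = 0` this is `0` by the conventions `0⁻¹ = 0`; the paper's `ρ_0 := limsup_{r→0⁺} ρ_r` is not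
used below — the degenerate case is handled by `avgPDHG_mem_saddleSet_of_normM_eq_zero`.)
[cite: ApplegateEtAl2022, §1 (4)] -/
noncomputable def rho (K : X →L[ℝ] Y) (C : Set X) (D : Set Y) (c : X) (b : Y) (τ σ : ℝ) (r : ℝ)
    (z : X × Y) : ℝ :=
  r⁻¹ * sSup ((fun ζ => gap K c b z ζ) '' {ζ : X × Y | ζ.1 ∈ C ∧ ζ.2 ∈ D ∧ normM K τ σ (ζ - z) ≤ r})

/-- **Property 3 (a) for PDHG in the printed form: `ρ_r(z̄^t) ≤ 2r/t` at `r = ‖z̄^t − z⁰‖_M`**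
(`C = 1`; `τ, σ > 0`, `τσ‖K‖² ≤ 1`, `C`, `D` convex, `t ≥ 1`).
[cite: ApplegateEtAl2022, Proposition 4 (Property 3 (i))] -/
theorem rho_avgPDHG_le [FiniteDimensional ℝ X] [FiniteDimensional ℝ Y] (K : X →L[ℝ] Y)
    {C : Set X} {D : Set Y} (hC : Convex ℝ C) (hD : Convex ℝ D) (c : X) (b : Y) {τ σ : ℝ}
    (hτ : 0 < τ) (hσ : 0 < σ) (hK : τ * σ * ‖K‖ ^ 2 ≤ 1) {jA : X → X} {jB : Y → Y}
    (hjA : IsResolventMap τ (shiftOp c (normalCone C)) jA)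
    (hjB : IsResolventMap σ (shiftOp b (normalCone D)) jB) (z₀ : X × Y) {t : ℕ} (ht : t ≠ 0) :
    rho K C D c b τ σ (normM K τ σ (avgPDHG K τ σ jA jB t z₀ - z₀)) (avgPDHG K τ σ jA jB t z₀) ≤
      2 * normM K τ σ (avgPDHG K τ σ jA jB t z₀ - z₀) / t := by
  set zb := avgPDHG K τ σ jA jB t z₀ with hzb
  set r := normM K τ σ (zb - z₀) with hr
  have hr0 : 0 ≤ r := normM_nonneg K τ σ _
  have ht' : (0 : ℝ) < t := Nat.cast_pos.mpr (Nat.pos_of_ne_zero ht)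
  rcases hr0.eq_or_lt with hr00 | hrpos
  · rw [← hr00]
    simp [rho]
  have hsup : sSup ((fun ζ => gap K c b zb ζ) ''
      {ζ : X × Y | ζ.1 ∈ C ∧ ζ.2 ∈ D ∧ normM K τ σ (ζ - zb) ≤ r}) ≤ 2 * r ^ 2 / t := by
    refine csSup_le ?_ ?_
    · refine ⟨gap K c b zb zb, zb, ⟨avgPDHG_fst_mem K hC hjA hjB z₀ ht,
        avgPDHG_snd_mem K hD hjA hjB z₀ ht, ?_⟩, rfl⟩
      rw [sub_self, normM_zero]
      exact hr0
    · rintro _ ⟨ζ, ⟨hζ1, hζ2, hζ⟩, rfl⟩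
      exact gap_avgPDHG_le_two_mul_sq K c b hτ hσ hK hjA hjB z₀ ht hζ1 hζ2 hζ
  unfold rho
  calc r⁻¹ * sSup ((fun ζ => gap K c b zb ζ) ''
        {ζ : X × Y | ζ.1 ∈ C ∧ ζ.2 ∈ D ∧ normM K τ σ (ζ - zb) ≤ r})
      ≤ r⁻¹ * (2 * r ^ 2 / t) := mul_le_mul_of_nonneg_left hsup (inv_nonneg.mpr hr0)
    _ = 2 * r / t := by field_simp

/-- **Property 3 (b) for PDHG in the printed form: `‖z̄^t − z⁰‖_M ≤ 2 · dist_M(z⁰, Z*)`** (`q = 0`;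
`Z* ≠ ∅`). [cite: ApplegateEtAl2022, Proposition 4 (Property 3 (ii))] -/
theorem normM_avgPDHG_sub_le_infDistM [FiniteDimensional ℝ X] [FiniteDimensional ℝ Y]
    (K : X →L[ℝ] Y) {C : Set X} {D : Set Y} (c : X) (b : Y) {τ σ : ℝ} (hτ : 0 < τ) (hσ : 0 < σ)
    (hK : τ * σ * ‖K‖ ^ 2 ≤ 1) {jA : X → X} {jB : Y → Y}
    (hjA : IsResolventMap τ (shiftOp c (normalCone C)) jA)
    (hjB : IsResolventMap σ (shiftOp b (normalCone D)) jB)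
    (hZ : (saddleSet K C D c b).Nonempty) (z₀ : X × Y) {t : ℕ} (ht : t ≠ 0) :
    normM K τ σ (avgPDHG K τ σ jA jB t z₀ - z₀) ≤ 2 * infDistM K τ σ z₀ (saddleSet K C D c b) := by
  have h : normM K τ σ (avgPDHG K τ σ jA jB t z₀ - z₀) / 2 ≤
      infDistM K τ σ z₀ (saddleSet K C D c b) := by
    refine le_infDistM K τ σ z₀ hZ fun zs hzs => ?_
    have h := normM_avgPDHG_sub_le K hτ hσ hK (isMonotone_shiftOp c (isMonotone_normalCone C))
      (isMonotone_shiftOp b (isMonotone_normalCone D)) hjA hjB hzs z₀ ht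
    linarith
  linarith

/-! ### Theorem 1 for restarted PDHG ([ApplegateEtAl2022, §4, Theorem 1] with Table 1's PDHG row) -/

/-- **Sharpness of the conic saddle on a set, in the `M`-geometry** ([ApplegateEtAl2022, Def. 1]
for the PDHG semi-norm): `α · dist_M(z, Z*) ≤ ρ_r(z)` for all `z ∈ S` and `0 < r ≤ diam_M(S)`.
[cite: ApplegateEtAl2022, Definition 1] -/
def IsSharpOn (K : X →L[ℝ] Y) (C : Set X) (D : Set Y) (c : X) (b : Y) (τ σ : ℝ) (S : Set (X × Y))
    (α : ℝ) : Prop :=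
  ∀ z ∈ S, ∀ r : ℝ, 0 < r → r ≤ diamM K τ σ S →
    α * infDistM K τ σ z (saddleSet K C D c b) ≤ rho K C D c b τ σ r z

omit [CompleteSpace X] [CompleteSpace Y] in
/-- Unfolding `IsSharpOn`. [cite: ApplegateEtAl2022, Definition 1] -/
theorem isSharpOn_iff [CompleteSpace X] [CompleteSpace Y] (K : X →L[ℝ] Y) (C : Set X) (D : Set Y)
    (c : X) (b : Y) (τ σ : ℝ) (S : Set (X × Y)) (α : ℝ) :
    IsSharpOn K C D c b τ σ S α ↔ ∀ z ∈ S, ∀ r : ℝ, 0 < r → r ≤ diamM K τ σ S →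
      α * infDistM K τ σ z (saddleSet K C D c b) ≤ rho K C D c b τ σ r z := Iff.rfl

/-- Sharpness for all radii `0 < r ≤ 2R` on the ball `W_R(z⁰)` implies sharpness on `W_R(z⁰)`
(`diam W_R(z⁰) ≤ 2R`). [cite: ApplegateEtAl2022, Definition 1 with Lemma 5 (proof: diam ≤ 2R)] -/
theorem isSharpOn_ballM_of_le_two_mul (K : X →L[ℝ] Y) (C : Set X) (D : Set Y) (c : X) (b : Y)
    {τ σ : ℝ} (hτ : 0 < τ) (hσ : 0 < σ) (hK : τ * σ * ‖K‖ ^ 2 ≤ 1) (z₀ : X × Y) {R α : ℝ}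
    (hR : 0 ≤ R)
    (h : ∀ z ∈ ballM K C D τ σ z₀ R, ∀ r : ℝ, 0 < r → r ≤ 2 * R →
      α * infDistM K τ σ z (saddleSet K C D c b) ≤ rho K C D c b τ σ r z) :
    IsSharpOn K C D c b τ σ (ballM K C D τ σ z₀ R) α :=
  fun z hz r hr0 hr => h z hz r hr0 (hr.trans (diamM_ballM_le K C D hτ hσ hK z₀ hR))

/-- All restarted iterates `z^{m,0} = T^[m] z^{0,0}` are feasible when `z^{0,0} ∈ C × D` ("we
initialize with `z^{0,0} ∈ Z`"; the later ones are averages of feasible iterates).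
[cite: ApplegateEtAl2022, §4 Algorithm 1 (z^{0,0} ∈ Z, z^{n+1,0} = z̄^{n,τ_n})] -/
theorem iterate_avgPDHG_mem [FiniteDimensional ℝ X] [FiniteDimensional ℝ Y] (K : X →L[ℝ] Y)
    {C : Set X} {D : Set Y} (hC : Convex ℝ C) (hD : Convex ℝ D) {c : X} {b : Y} {τ σ : ℝ}
    {jA : X → X} {jB : Y → Y} (hjA : IsResolventMap τ (shiftOp c (normalCone C)) jA)
    (hjB : IsResolventMap σ (shiftOp b (normalCone D)) jB) {t : ℕ} (ht : t ≠ 0) {z₀ : X × Y}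
    (hz₀ : z₀.1 ∈ C ∧ z₀.2 ∈ D) (m : ℕ) :
    ((avgPDHG K τ σ jA jB t)^[m] z₀).1 ∈ C ∧ ((avgPDHG K τ σ jA jB t)^[m] z₀).2 ∈ D := by
  induction m with
  | zero => exact hz₀
  | succ m _ =>
      rw [Function.iterate_succ_apply']
      exact ⟨avgPDHG_fst_mem K hC hjA hjB _ ht, avgPDHG_snd_mem K hD hjA hjB _ ht⟩

/-- Partial geometric sums stay below `(1 − β)⁻¹` for `0 ≤ β < 1`. [folklore] -/
private theorem geom_sum_le_inv {β : ℝ} (hβ0 : 0 ≤ β) (hβ1 : β < 1) (m : ℕ) :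
    ∑ k ∈ Finset.range m, β ^ k ≤ (1 - β)⁻¹ := by
  have h1 : 0 < 1 - β := by linarith
  have hsum : (∑ k ∈ Finset.range m, β ^ k) * (1 - β) = 1 - β ^ m := by
    have := geom_sum_mul_neg β m
    linarith [this]
  have hm : 0 ≤ β ^ m := pow_nonneg hβ0 m
  rw [inv_eq_one_div, le_div_iff₀ h1]
  nlinarith [hsum, hm]

/-- Telescoping triangle inequality `‖f m − f 0‖_M ≤ Σ_{k<m} ‖f (k+1) − f k‖_M`.
[cite: ApplegateEtAl2022, Theorem 1 (proof, first display)] -/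
private theorem normM_sub_le_sum (K : X →L[ℝ] Y) {τ σ : ℝ} (hτ : 0 < τ) (hσ : 0 < σ)
    (hK : τ * σ * ‖K‖ ^ 2 ≤ 1) (f : ℕ → X × Y) (m : ℕ) :
    normM K τ σ (f m - f 0) ≤ ∑ k ∈ Finset.range m, normM K τ σ (f (k + 1) - f k) := by
  induction m with
  | zero => simp [normM_zero]
  | succ m ih =>
      rw [Finset.sum_range_succ]
      exact (normM_sub_le K hτ hσ hK (f (m + 1)) (f m) (f 0)).trans (by linarith)

/-- The first display of the proof of [ApplegateEtAl2022, Thm 1] for restarted PDHG: as long as the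
distances to `Z*` contract geometrically up to restart `N`, every `z^{m,0}` with `m ≤ N + 1` stays
within `R = 2/(1 − β) · dist_M(z^{0,0}, Z*)` of the start (`q + 2 = 2` for PDHG).
[cite: ApplegateEtAl2022, Theorem 1 (proof, first display)] -/
theorem normM_iterate_avgPDHG_sub_le [FiniteDimensional ℝ X] [FiniteDimensional ℝ Y]
    (K : X →L[ℝ] Y) {C : Set X} {D : Set Y} (c : X) (b : Y) {τ σ : ℝ} (hτ : 0 < τ) (hσ : 0 < σ)
    (hK : τ * σ * ‖K‖ ^ 2 ≤ 1) {jA : X → X} {jB : Y → Y}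
    (hjA : IsResolventMap τ (shiftOp c (normalCone C)) jA)
    (hjB : IsResolventMap σ (shiftOp b (normalCone D)) jB)
    (hZ : (saddleSet K C D c b).Nonempty) {t : ℕ} (ht : t ≠ 0) {β : ℝ} (hβ0 : 0 ≤ β)
    (hβ1 : β < 1) (z₀ : X × Y) {N : ℕ}
    (hN : ∀ n ≤ N, infDistM K τ σ ((avgPDHG K τ σ jA jB t)^[n] z₀) (saddleSet K C D c b) ≤
      β ^ n * infDistM K τ σ z₀ (saddleSet K C D c b))
    {m : ℕ} (hm : m ≤ N + 1) :
    normM K τ σ ((avgPDHG K τ σ jA jB t)^[m] z₀ - z₀) ≤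
      2 / (1 - β) * infDistM K τ σ z₀ (saddleSet K C D c b) := by
  set T := avgPDHG K τ σ jA jB t with hT
  set d₀ := infDistM K τ σ z₀ (saddleSet K C D c b) with hd₀
  have h1 : 0 < 1 - β := by linarith
  have hd0 : 0 ≤ d₀ := infDistM_nonneg K τ σ _ _
  have htri : normM K τ σ (T^[m] z₀ - z₀) ≤
      ∑ k ∈ Finset.range m, normM K τ σ (T^[k + 1] z₀ - T^[k] z₀) := by
    have h := normM_sub_le_sum K hτ hσ hK (fun k => T^[k] z₀) m
    simpa using h
  have hstep : ∀ k ∈ Finset.range m,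
      normM K τ σ (T^[k + 1] z₀ - T^[k] z₀) ≤ 2 * (β ^ k * d₀) := by
    intro k hk
    have hkN : k ≤ N := by
      have := Finset.mem_range.mp hk
      omega
    rw [Function.iterate_succ_apply']
    exact (normM_avgPDHG_sub_le_infDistM K c b hτ hσ hK hjA hjB hZ _ ht).trans
      (mul_le_mul_of_nonneg_left (hN k hkN) (by norm_num))
  calc normM K τ σ (T^[m] z₀ - z₀)
      ≤ ∑ k ∈ Finset.range m, normM K τ σ (T^[k + 1] z₀ - T^[k] z₀) := htri
    _ ≤ ∑ k ∈ Finset.range m, 2 * (β ^ k * d₀) := Finset.sum_le_sum hstep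
    _ = 2 * d₀ * ∑ k ∈ Finset.range m, β ^ k := by
        rw [Finset.mul_sum]
        exact Finset.sum_congr rfl fun k _ => by ring
    _ ≤ 2 * d₀ * (1 - β)⁻¹ :=
        mul_le_mul_of_nonneg_left (geom_sum_le_inv hβ0 hβ1 m) (by positivity)
    _ = 2 / (1 - β) * d₀ := by
        rw [div_eq_mul_inv]; ring

/-- **Restarted PDHG converges linearly on sharp conic saddles** ([ApplegateEtAl2022, Theorem 1]
with the PDHG row of Table 1: `C = 1` in `‖·‖_{M_{τ,σ}}`, `q = 0`). Setting: `X`, `Y` finite-dimensional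
real Hilbert spaces, `C ⊆ X`, `D ⊆ Y` convex, `L(x, y) = ⟨c, x⟩ + ⟨Kx, y⟩ − ⟨b, y⟩` with a nonempty
saddle set `Z*`, PDHG with the resolvent maps of `c + N_C`, `b + N_D` (e.g. the projections
`P_C(· − τc)`, `P_D(· − σb)`), `τ, σ > 0`, `τσ‖K‖² ≤ 1`; the restart map `T = T_t` runs `t` PDHG steps
and outputs the average (fixed frequency `t`), started at a feasible `z^{0,0} ∈ C × D`. If `0 ≤ β < 1`,
`4/(α t) ≤ β` (i.e. `t ≥ t* = 2C(q+2)/(αβ)`) and the problem is `α`-sharp (`α > 0`) in the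
`M`-geometry on the feasible ball `W_R(z^{0,0})`,
`R = 2/(1 − β) · dist_M(z^{0,0}, Z*)`, then for every `n`,
`dist_M(z^{n,0}, Z*) ≤ βⁿ · dist_M(z^{0,0}, Z*)`, `z^{n,0} = T^[n] z^{0,0}`.
Proof as printed (induction; the iterates stay in the ball; sharpness at `z^{N+1,0}` with
`r = ‖z^{N+1,0} − z^{N,0}‖_M`; Property 3 (a), (b); the choice of `t`), the degenerate case `r = 0`
by Proposition 8. By `euclidean_le_normM_sq` the conclusion is a Euclidean linear rate whenever
`τσ‖K‖² < 1`. [cite: ApplegateEtAl2022, Theorem 1 (with Propositions 1–4 and 8 for PDHG)] -/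
theorem infDistM_iterate_avgPDHG_le_pow [FiniteDimensional ℝ X] [FiniteDimensional ℝ Y]
    (K : X →L[ℝ] Y) {C : Set X} {D : Set Y} (hC : Convex ℝ C) (hD : Convex ℝ D) (c : X) (b : Y)
    {τ σ : ℝ} (hτ : 0 < τ) (hσ : 0 < σ) (hK : τ * σ * ‖K‖ ^ 2 ≤ 1) {jA : X → X} {jB : Y → Y}
    (hjA : IsResolventMap τ (shiftOp c (normalCone C)) jA)
    (hjB : IsResolventMap σ (shiftOp b (normalCone D)) jB)
    (hZ : (saddleSet K C D c b).Nonempty) {t : ℕ} (ht : t ≠ 0) {α β : ℝ} (hα : 0 < α)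
    (hβ0 : 0 ≤ β) (hβ1 : β < 1) (htstar : 4 / (α * t) ≤ β) {z₀ : X × Y}
    (hz₀ : z₀.1 ∈ C ∧ z₀.2 ∈ D)
    (hsharp : IsSharpOn K C D c b τ σ
      (ballM K C D τ σ z₀ (2 / (1 - β) * infDistM K τ σ z₀ (saddleSet K C D c b))) α)
    (n : ℕ) :
    infDistM K τ σ ((avgPDHG K τ σ jA jB t)^[n] z₀) (saddleSet K C D c b) ≤
      β ^ n * infDistM K τ σ z₀ (saddleSet K C D c b) := by
  set T := avgPDHG K τ σ jA jB t with hT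
  set Zs := saddleSet K C D c b with hZs
  set d₀ := infDistM K τ σ z₀ Zs with hd₀
  set R := 2 / (1 - β) * d₀ with hR
  have hd0 : 0 ≤ d₀ := infDistM_nonneg K τ σ _ _
  have ht' : (0 : ℝ) < t := Nat.cast_pos.mpr (Nat.pos_of_ne_zero ht)
  -- strong induction packaged as a statement about all `n ≤ N`
  suffices hall : ∀ N, ∀ n ≤ N, infDistM K τ σ (T^[n] z₀) Zs ≤ β ^ n * d₀ from hall n n le_rfl
  intro N
  induction N with
  | zero =>
      intro n hn
      rw [Nat.le_zero.mp hn, Function.iterate_zero, id_eq, pow_zero, one_mul]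
  | succ N ih =>
      intro n hn
      rcases Nat.lt_or_eq_of_le hn with hlt | rfl
      · exact ih n (Nat.lt_succ_iff.mp hlt)
      -- the new case `n = N + 1`; the two last restarts lie in the ball
      have hmem1 : T^[N + 1] z₀ ∈ ballM K C D τ σ z₀ R :=
        (mem_ballM_iff K C D τ σ z₀ R _).mpr
          ⟨(iterate_avgPDHG_mem K hC hD hjA hjB ht hz₀ (N + 1)).1,
            (iterate_avgPDHG_mem K hC hD hjA hjB ht hz₀ (N + 1)).2,
            normM_iterate_avgPDHG_sub_le K c b hτ hσ hK hjA hjB hZ ht hβ0 hβ1 z₀ ih le_rfl⟩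
      have hmem0 : T^[N] z₀ ∈ ballM K C D τ σ z₀ R :=
        (mem_ballM_iff K C D τ σ z₀ R _).mpr
          ⟨(iterate_avgPDHG_mem K hC hD hjA hjB ht hz₀ N).1,
            (iterate_avgPDHG_mem K hC hD hjA hjB ht hz₀ N).2,
            normM_iterate_avgPDHG_sub_le K c b hτ hσ hK hjA hjB hZ ht hβ0 hβ1 z₀ ih
              (Nat.le_succ N)⟩
      have hTN : T^[N + 1] z₀ = T (T^[N] z₀) := Function.iterate_succ_apply' T N z₀
      set r := normM K τ σ (T^[N + 1] z₀ - T^[N] z₀) with hr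
      have hr0 : 0 ≤ r := normM_nonneg K τ σ _
      have hβN : 0 ≤ β ^ (N + 1) * d₀ := by positivity
      rcases hr0.eq_or_lt with hr00 | hrpos
      · -- degenerate case: `z^{N+1,0}` is a saddle point (Proposition 8)
        have hmem : T^[N + 1] z₀ ∈ Zs := by
          rw [hTN]
          refine avgPDHG_mem_saddleSet_of_normM_eq_zero K hC hD c b hτ hσ hK hjA hjB _ ht ?_
          show normM K τ σ (T (T^[N] z₀) - T^[N] z₀) = 0
          rw [← hTN]
          exact hr00.symm
        rw [infDistM_of_mem K τ σ hmem]
        exact hβN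
      -- generic case: sharpness at `z^{N+1,0}` with radius `r`
      have hrdiam : r ≤ diamM K τ σ (ballM K C D τ σ z₀ R) :=
        normM_sub_le_diamM_ballM K hτ hσ hK z₀ R hmem1 hmem0
      have h1 : α * infDistM K τ σ (T^[N + 1] z₀) Zs ≤ rho K C D c b τ σ r (T^[N + 1] z₀) :=
        hsharp _ hmem1 r hrpos hrdiam
      -- Property 3 (a): `ρ_r(z^{N+1,0}) ≤ 2r/t`
      have h2 : rho K C D c b τ σ r (T^[N + 1] z₀) ≤ 2 * r / t := by
        have h := rho_avgPDHG_le K hC hD c b hτ hσ hK hjA hjB (T^[N] z₀) ht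
        rw [← hT, ← hTN] at h
        exact h
      -- Property 3 (b) and the induction hypothesis: `r ≤ 2 βᴺ d₀`
      have h3 : r ≤ 2 * (β ^ N * d₀) := by
        have h := normM_avgPDHG_sub_le_infDistM K c b hτ hσ hK hjA hjB hZ (T^[N] z₀) ht
        rw [← hT, ← hTN] at h
        exact h.trans (mul_le_mul_of_nonneg_left (ih N le_rfl) (by norm_num))
      -- assemble: `α d_{N+1} ≤ 4 βᴺ d₀ / t ≤ α β^{N+1} d₀`
      have h4 : α * infDistM K τ σ (T^[N + 1] z₀) Zs ≤ 4 / (α * t) * (α * (β ^ N * d₀)) := by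
        have h23 : 2 * r / t ≤ 2 * (2 * (β ^ N * d₀)) / t :=
          div_le_div_of_nonneg_right (by linarith) ht'.le
        refine (h1.trans (h2.trans h23)).trans (le_of_eq ?_)
        field_simp
        ring
      have hβN' : 0 ≤ α * (β ^ N * d₀) := by positivity
      have h5 : α * infDistM K τ σ (T^[N + 1] z₀) Zs ≤ β * (α * (β ^ N * d₀)) :=
        h4.trans (mul_le_mul_of_nonneg_right htstar hβN')
      have h6 : infDistM K τ σ (T^[N + 1] z₀) Zs ≤ β * (β ^ N * d₀) := by
        have : α * infDistM K τ σ (T^[N + 1] z₀) Zs ≤ α * (β * (β ^ N * d₀)) := by linarith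
        exact le_of_mul_le_mul_left this hα
      calc infDistM K τ σ (T^[N + 1] z₀) Zs ≤ β * (β ^ N * d₀) := h6
        _ = β ^ (N + 1) * d₀ := by ring

/-- The iteration-count reading ([ApplegateEtAl2022, Remark after Thm 1]): to reach
`dist_M(z^{n,0}, Z*) ≤ ε` it suffices that `βⁿ · dist_M(z^{0,0}, Z*) ≤ ε` — with `t = ⌈4/(αβ)⌉` inner
steps per restart this is `O((1/α) log(1/ε))` PDHG steps in total.
[cite: ApplegateEtAl2022, Theorem 1 and the Remark following it] -/
theorem infDistM_iterate_avgPDHG_le_of_pow_le [FiniteDimensional ℝ X] [FiniteDimensional ℝ Y]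
    (K : X →L[ℝ] Y) {C : Set X} {D : Set Y} (hC : Convex ℝ C) (hD : Convex ℝ D) (c : X) (b : Y)
    {τ σ : ℝ} (hτ : 0 < τ) (hσ : 0 < σ) (hK : τ * σ * ‖K‖ ^ 2 ≤ 1) {jA : X → X} {jB : Y → Y}
    (hjA : IsResolventMap τ (shiftOp c (normalCone C)) jA)
    (hjB : IsResolventMap σ (shiftOp b (normalCone D)) jB)
    (hZ : (saddleSet K C D c b).Nonempty) {t : ℕ} (ht : t ≠ 0) {α β : ℝ} (hα : 0 < α)
    (hβ0 : 0 ≤ β) (hβ1 : β < 1) (htstar : 4 / (α * t) ≤ β) {z₀ : X × Y}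
    (hz₀ : z₀.1 ∈ C ∧ z₀.2 ∈ D)
    (hsharp : IsSharpOn K C D c b τ σ
      (ballM K C D τ σ z₀ (2 / (1 - β) * infDistM K τ σ z₀ (saddleSet K C D c b))) α)
    {ε : ℝ} {n : ℕ} (hn : β ^ n * infDistM K τ σ z₀ (saddleSet K C D c b) ≤ ε) :
    infDistM K τ σ ((avgPDHG K τ σ jA jB t)^[n] z₀) (saddleSet K C D c b) ≤ ε :=
  (infDistM_iterate_avgPDHG_le_pow K hC hD c b hτ hσ hK hjA hjB hZ ht hα hβ0 hβ1 htstar hz₀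
    hsharp n).trans hn

/-! ### Adaptive restarts for PDHG ([ApplegateEtAl2022, Theorem 2] with `C = 1`, `q = 0`) -/

/-- **The adaptive restart criterion is met by time `t*` (PDHG)** — the content of
[ApplegateEtAl2022, Thm 2 (i)] for restarted PDHG: let `z^{n,0} = z̄^{t'}(z^{n−1,0})` be a restart
point, let both `z^{n−1,0}` and `z^{n,0}` lie in a feasible ball `W_R(w)` on which the problem is
`α`-sharp, and let `t₁ ≥ 1` satisfy `4/(α t₁) ≤ β`. Then the adaptive condition
`ρ_{‖z̄ − z^{n,0}‖}(z̄) ≤ β · ρ_{‖z^{n,0} − z^{n−1,0}‖}(z^{n,0})` holds for `z̄ = z̄^{t₁}(z^{n,0})`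
(Property 3 (i), sharpness at `z^{n,0}`, Property 3 (ii), choice of `t₁`; the degenerate case
`‖z^{n,0} − z^{n−1,0}‖_M = 0` by Proposition 8: then `z^{n,0} ∈ Z*` and both sides vanish).
[cite: ApplegateEtAl2022, Theorem 2 (i) (proof)] -/
theorem adaptive_condition_avgPDHG [FiniteDimensional ℝ X] [FiniteDimensional ℝ Y]
    (K : X →L[ℝ] Y) {C : Set X} {D : Set Y} (hC : Convex ℝ C) (hD : Convex ℝ D) (c : X) (b : Y)
    {τ σ : ℝ} (hτ : 0 < τ) (hσ : 0 < σ) (hK : τ * σ * ‖K‖ ^ 2 ≤ 1) {jA : X → X} {jB : Y → Y}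
    (hjA : IsResolventMap τ (shiftOp c (normalCone C)) jA)
    (hjB : IsResolventMap σ (shiftOp b (normalCone D)) jB)
    (hZ : (saddleSet K C D c b).Nonempty) {w : X × Y} {R α β : ℝ} (hα : 0 < α)
    (hsharp : IsSharpOn K C D c b τ σ (ballM K C D τ σ w R) α) {zprev zn : X × Y} {t' : ℕ}
    (ht' : t' ≠ 0) (hzn : zn = avgPDHG K τ σ jA jB t' zprev) (hprev : zprev ∈ ballM K C D τ σ w R)
    (hn : zn ∈ ballM K C D τ σ w R) {t₁ : ℕ} (ht₁ : t₁ ≠ 0) (htstar : 4 / (α * t₁) ≤ β) :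
    rho K C D c b τ σ (normM K τ σ (avgPDHG K τ σ jA jB t₁ zn - zn)) (avgPDHG K τ σ jA jB t₁ zn) ≤
      β * rho K C D c b τ σ (normM K τ σ (zn - zprev)) zn := by
  have ht₁' : (0 : ℝ) < t₁ := Nat.cast_pos.mpr (Nat.pos_of_ne_zero ht₁)
  set Zs := saddleSet K C D c b with hZs
  set r := normM K τ σ (zn - zprev) with hr
  set zb := avgPDHG K τ σ jA jB t₁ zn with hzb
  set r' := normM K τ σ (zb - zn) with hr'
  have hr0 : 0 ≤ r := normM_nonneg K τ σ _
  have hr'0 : 0 ≤ r' := normM_nonneg K τ σ _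
  -- Property 3 (i) at `z^{n,0}` with inner length `t₁`, and Property 3 (ii)
  have hP3a : rho K C D c b τ σ r' zb ≤ 2 * r' / t₁ :=
    rho_avgPDHG_le K hC hD c b hτ hσ hK hjA hjB zn ht₁
  have hP3b : r' ≤ 2 * infDistM K τ σ zn Zs :=
    normM_avgPDHG_sub_le_infDistM K c b hτ hσ hK hjA hjB hZ zn ht₁
  rcases hr0.eq_or_lt with hr00 | hrpos
  · -- degenerate case: `z^{n,0} ∈ Z*` (Proposition 8), so `r' = 0` and both sides vanish
    have hmem : zn ∈ Zs := by
      rw [hzn]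
      refine avgPDHG_mem_saddleSet_of_normM_eq_zero K hC hD c b hτ hσ hK hjA hjB zprev ht' ?_
      rw [← hzn]
      exact hr00.symm
    have hd0 : infDistM K τ σ zn Zs = 0 := infDistM_of_mem K τ σ hmem
    have hr'00 : r' = 0 := le_antisymm (by linarith [hP3b, hd0]) hr'0
    rw [← hr00, hr'00]
    simp [rho]
  -- generic case: sharpness at `z^{n,0}` with radius `r`
  have hsh : α * infDistM K τ σ zn Zs ≤ rho K C D c b τ σ r zn :=
    hsharp zn hn r hrpos (normM_sub_le_diamM_ballM K hτ hσ hK w R hn hprev)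
  have hρ0 : 0 ≤ rho K C D c b τ σ r zn :=
    le_trans (mul_nonneg hα.le (infDistM_nonneg K τ σ _ _)) hsh
  have h1 : 2 * r' / t₁ ≤ 2 * (2 * infDistM K τ σ zn Zs) / t₁ :=
    div_le_div_of_nonneg_right (by linarith) ht₁'.le
  have h2 : 2 * (2 * infDistM K τ σ zn Zs) / t₁ ≤ 4 / (α * t₁) * rho K C D c b τ σ r zn := by
    have e : 2 * (2 * infDistM K τ σ zn Zs) / t₁ = 4 / (α * t₁) * (α * infDistM K τ σ zn Zs) := by
      field_simp
      ring
    rw [e]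
    exact mul_le_mul_of_nonneg_left hsh (by positivity)
  have h3 : 4 / (α * t₁) * rho K C D c b τ σ r zn ≤ β * rho K C D c b τ σ r zn :=
    mul_le_mul_of_nonneg_right htstar hρ0
  exact hP3a.trans (h1.trans (h2.trans h3))

/-- **[ApplegateEtAl2022, Theorem 2 (i)] for PDHG: adaptive restart lengths are at most `t*`.** In the
setting of `adaptive_condition_avgPDHG`, if the restart from `z^{n,0}` happens at the FIRST inner
length `τ_n ≥ 1` at which the adaptive condition holds, then `τ_n ≤ t₁` for every `t₁ ≥ 1` with
`4/(α t₁) ≤ β`, i.e. `τ_n ≤ t* = ⌈4/(αβ)⌉`. [cite: ApplegateEtAl2022, Theorem 2 (i)] -/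
theorem adaptive_length_avgPDHG_le [FiniteDimensional ℝ X] [FiniteDimensional ℝ Y]
    (K : X →L[ℝ] Y) {C : Set X} {D : Set Y} (hC : Convex ℝ C) (hD : Convex ℝ D) (c : X) (b : Y)
    {τ σ : ℝ} (hτ : 0 < τ) (hσ : 0 < σ) (hK : τ * σ * ‖K‖ ^ 2 ≤ 1) {jA : X → X} {jB : Y → Y}
    (hjA : IsResolventMap τ (shiftOp c (normalCone C)) jA)
    (hjB : IsResolventMap σ (shiftOp b (normalCone D)) jB)
    (hZ : (saddleSet K C D c b).Nonempty) {w : X × Y} {R α β : ℝ} (hα : 0 < α)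
    (hsharp : IsSharpOn K C D c b τ σ (ballM K C D τ σ w R) α) {zprev zn : X × Y} {t' : ℕ}
    (ht' : t' ≠ 0) (hzn : zn = avgPDHG K τ σ jA jB t' zprev) (hprev : zprev ∈ ballM K C D τ σ w R)
    (hn : zn ∈ ballM K C D τ σ w R) {τn : ℕ}
    (hfirst : ∀ t : ℕ, t ≠ 0 → t < τn →
      ¬ rho K C D c b τ σ (normM K τ σ (avgPDHG K τ σ jA jB t zn - zn)) (avgPDHG K τ σ jA jB t zn) ≤
        β * rho K C D c b τ σ (normM K τ σ (zn - zprev)) zn)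
    {t₁ : ℕ} (ht₁ : t₁ ≠ 0) (htstar : 4 / (α * t₁) ≤ β) : τn ≤ t₁ := by
  by_contra hlt
  push Not at hlt
  exact hfirst t₁ ht₁ hlt (adaptive_condition_avgPDHG K hC hD c b hτ hσ hK hjA hjB hZ hα hsharp
    ht' hzn hprev hn ht₁ htstar)

/-- **[ApplegateEtAl2022, Theorem 2 (ii)] for PDHG: linear convergence of adaptively restarted PDHG.**
Let `z^{n+1,0} = z̄^{τ_n}(z^{n,0})` (inner lengths `τ_n ≥ 1`, feasible start `z^{0,0} ∈ C × D`), assume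
the adaptive restart condition `ρ_{‖z^{n+2,0} − z^{n+1,0}‖}(z^{n+2,0}) ≤ β ρ_{‖z^{n+1,0} − z^{n,0}‖}(z^{n+1,0})`
at every restart, and let all restart points lie in a feasible ball `W_R(w)` on which the problem is
`α`-sharp in the `M`-geometry. Then for every `n`,
`dist_M(z^{n+1,0}, Z*) ≤ βⁿ · (4/(α τ₀)) · dist_M(z^{0,0}, Z*)` (= the printed `βⁿ (t*/τ₀) dist(z^{0,0}, Z*)`
with `C = 1`, `q = 0`). Proof as printed (sharpness at `z^{n+1,0}`, the condition recursively,
Property 3 for the first restart); the degenerate radius by Proposition 8.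
[cite: ApplegateEtAl2022, Theorem 2 (ii)] -/
theorem infDistM_adaptive_avgPDHG_le [FiniteDimensional ℝ X] [FiniteDimensional ℝ Y]
    (K : X →L[ℝ] Y) {C : Set X} {D : Set Y} (hC : Convex ℝ C) (hD : Convex ℝ D) (c : X) (b : Y)
    {τ σ : ℝ} (hτ : 0 < τ) (hσ : 0 < σ) (hK : τ * σ * ‖K‖ ^ 2 ≤ 1) {jA : X → X} {jB : Y → Y}
    (hjA : IsResolventMap τ (shiftOp c (normalCone C)) jA)
    (hjB : IsResolventMap σ (shiftOp b (normalCone D)) jB)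
    (hZ : (saddleSet K C D c b).Nonempty) {w : X × Y} {R α β : ℝ} (hα : 0 < α) (hβ : 0 ≤ β)
    (hsharp : IsSharpOn K C D c b τ σ (ballM K C D τ σ w R) α) {z : ℕ → X × Y} {τs : ℕ → ℕ}
    (hτs : ∀ n, τs n ≠ 0) (hz : ∀ n, z (n + 1) = avgPDHG K τ σ jA jB (τs n) (z n))
    (hzS : ∀ n, z n ∈ ballM K C D τ σ w R)
    (hcond : ∀ n, rho K C D c b τ σ (normM K τ σ (z (n + 2) - z (n + 1))) (z (n + 2)) ≤
      β * rho K C D c b τ σ (normM K τ σ (z (n + 1) - z n)) (z (n + 1)))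
    (n : ℕ) :
    infDistM K τ σ (z (n + 1)) (saddleSet K C D c b) ≤
      β ^ n * (4 / (α * τs 0)) * infDistM K τ σ (z 0) (saddleSet K C D c b) := by
  set Zs := saddleSet K C D c b with hZs
  set g : ℕ → ℝ := fun k => rho K C D c b τ σ (normM K τ σ (z (k + 1) - z k)) (z (k + 1)) with hg
  -- geometric decay of the potentials
  have hgeo : ∀ k, g k ≤ β ^ k * g 0 := by
    intro k
    induction k with
    | zero => simp
    | succ k ih =>
        calc g (k + 1) ≤ β * g k := hcond k
          _ ≤ β * (β ^ k * g 0) := mul_le_mul_of_nonneg_left ih hβ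
          _ = β ^ (k + 1) * g 0 := by ring
  -- the first potential: Property 3 (i) and (ii) at `z^{0,0}`
  have hτ0 : (0 : ℝ) < τs 0 := Nat.cast_pos.mpr (Nat.pos_of_ne_zero (hτs 0))
  have hd0 : 0 ≤ infDistM K τ σ (z 0) Zs := infDistM_nonneg K τ σ _ _
  have hfirst : g 0 ≤ 4 / τs 0 * infDistM K τ σ (z 0) Zs := by
    have h1 : g 0 ≤ 2 * normM K τ σ (z 1 - z 0) / τs 0 := by
      have h := rho_avgPDHG_le K hC hD c b hτ hσ hK hjA hjB (z 0) (hτs 0)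
      rw [← hz 0] at h
      exact h
    have h2 : normM K τ σ (z 1 - z 0) ≤ 2 * infDistM K τ σ (z 0) Zs := by
      have h := normM_avgPDHG_sub_le_infDistM K c b hτ hσ hK hjA hjB hZ (z 0) (hτs 0)
      rw [← hz 0] at h
      exact h
    calc g 0 ≤ 2 * normM K τ σ (z 1 - z 0) / τs 0 := h1
      _ ≤ 2 * (2 * infDistM K τ σ (z 0) Zs) / τs 0 :=
          div_le_div_of_nonneg_right (by linarith) hτ0.le
      _ = 4 / τs 0 * infDistM K τ σ (z 0) Zs := by
          field_simp
          ring
  have hRHS : 0 ≤ β ^ n * (4 / (α * τs 0)) * infDistM K τ σ (z 0) Zs := by positivity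
  -- sharpness at `z^{n+1,0}` with radius `r = ‖z^{n+1,0} − z^{n,0}‖_M`, or Proposition 8
  set r := normM K τ σ (z (n + 1) - z n) with hr
  have hr0 : 0 ≤ r := normM_nonneg K τ σ _
  rcases hr0.eq_or_lt with hr00 | hrpos
  · have hmem : z (n + 1) ∈ Zs := by
      rw [hz n]
      refine avgPDHG_mem_saddleSet_of_normM_eq_zero K hC hD c b hτ hσ hK hjA hjB (z n) (hτs n) ?_
      rw [← hz n]
      exact hr00.symm
    rw [infDistM_of_mem K τ σ hmem]
    exact hRHS
  have hsh : α * infDistM K τ σ (z (n + 1)) Zs ≤ g n :=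
    hsharp (z (n + 1)) (hzS _) r hrpos (normM_sub_le_diamM_ballM K hτ hσ hK w R (hzS _) (hzS _))
  have hmain : α * infDistM K τ σ (z (n + 1)) Zs ≤
      β ^ n * (4 / τs 0 * infDistM K τ σ (z 0) Zs) :=
    hsh.trans ((hgeo n).trans (mul_le_mul_of_nonneg_left hfirst (pow_nonneg hβ n)))
  have e : β ^ n * (4 / (α * τs 0)) * infDistM K τ σ (z 0) Zs =
      α⁻¹ * (β ^ n * (4 / τs 0 * infDistM K τ σ (z 0) Zs)) := by
    field_simp
  rw [e, ← div_eq_inv_mul, le_div_iff₀ hα, mul_comm]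
  exact hmain

/-! ### Restart points stay in a bounded region ([ApplegateEtAl2022, Proposition 9], PDHG case) and
the iteration count of Theorem 1 ([ApplegateEtAl2022, Remark 3]) -/

/-- `z̄^t − v = t⁻¹ Σ_{i=1}^t (z^i − v)` for any reference point `v`.
[cite: ApplegateEtAl2022, Proposition 9 (proof, first display)] -/
theorem avgPDHG_sub_const_eq [FiniteDimensional ℝ X] [FiniteDimensional ℝ Y] (K : X →L[ℝ] Y)
    (τ σ : ℝ) (jA : X → X) (jB : Y → Y) {t : ℕ} (ht : t ≠ 0) (z₀ v : X × Y) :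
    avgPDHG K τ σ jA jB t z₀ - v =
      (t : ℝ)⁻¹ • ∑ i ∈ Finset.range t, (pdhgIter K τ σ jA jB z₀ (i + 1) - v) := by
  unfold avgPDHG xAvg yAvg
  ext
  · simp only [Prod.fst_sub, Prod.smul_fst, Prod.fst_sum]
    exact avg_sub_const _ _ ht
  · simp only [Prod.snd_sub, Prod.smul_snd, Prod.snd_sum]
    exact avg_sub_const _ _ ht

/-- **Fejér monotonicity survives averaging:** `‖z̄^t − z*‖_M ≤ ‖z⁰ − z*‖_M` for every KKT point `z*`
(triangle inequality under the average + non-expansiveness of each PDHG step).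
[cite: ApplegateEtAl2022, Proposition 9 (proof, first display)] -/
theorem normM_avgPDHG_sub_saddle_le [FiniteDimensional ℝ X] [FiniteDimensional ℝ Y]
    (K : X →L[ℝ] Y) {A : Set (X × X)} {B : Set (Y × Y)} {τ σ : ℝ} (hτ : 0 < τ) (hσ : 0 < σ)
    (hK : τ * σ * ‖K‖ ^ 2 ≤ 1) (hA : IsMonotone A) (hB : IsMonotone B) {jA : X → X} {jB : Y → Y}
    (hjA : IsResolventMap τ A jA) (hjB : IsResolventMap σ B jB) {zs : X × Y}
    (hzs : WithLp.toLp 2 zs ∈ zer (kkt K A B)) (z₀ : X × Y) {t : ℕ} (ht : t ≠ 0) :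
    normM K τ σ (avgPDHG K τ σ jA jB t z₀ - zs) ≤ normM K τ σ (z₀ - zs) := by
  have ht' : (0 : ℝ) < t := Nat.cast_pos.mpr (Nat.pos_of_ne_zero ht)
  rw [avgPDHG_sub_const_eq K τ σ jA jB ht, normM_smul, abs_of_pos (inv_pos.mpr ht')]
  calc (t : ℝ)⁻¹ * normM K τ σ (∑ i ∈ Finset.range t, (pdhgIter K τ σ jA jB z₀ (i + 1) - zs))
      ≤ (t : ℝ)⁻¹ * ∑ i ∈ Finset.range t, normM K τ σ (pdhgIter K τ σ jA jB z₀ (i + 1) - zs) :=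
        mul_le_mul_of_nonneg_left (normM_sum_le K hτ hσ hK _ _) (inv_nonneg.mpr ht'.le)
    _ ≤ (t : ℝ)⁻¹ * ∑ _i ∈ Finset.range t, normM K τ σ (z₀ - zs) :=
        mul_le_mul_of_nonneg_left (Finset.sum_le_sum fun i _ =>
          normM_pdhgIter_sub_le K hτ hσ hK hA hB hjA hjB hzs z₀ _) (inv_nonneg.mpr ht'.le)
    _ = normM K τ σ (z₀ - zs) := by
        rw [Finset.sum_const, Finset.card_range, nsmul_eq_mul]
        field_simp

/-- **Restart points contract towards every saddle point:** for ANY restart lengths `τ_n ≥ 1`, the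
restart points `z^{n+1,0} = z̄^{n,τ_n}` of restarted PDHG satisfy `‖z^{n,0} − z*‖_M ≤ ‖z^{0,0} − z*‖_M`
for every KKT point `z*` (induction on the previous lemma).
[cite: ApplegateEtAl2022, Proposition 9 (proof, second display and the induction)] -/
theorem normM_restart_sub_saddle_le [FiniteDimensional ℝ X] [FiniteDimensional ℝ Y]
    (K : X →L[ℝ] Y) {A : Set (X × X)} {B : Set (Y × Y)} {τ σ : ℝ} (hτ : 0 < τ) (hσ : 0 < σ)
    (hK : τ * σ * ‖K‖ ^ 2 ≤ 1) (hA : IsMonotone A) (hB : IsMonotone B) {jA : X → X} {jB : Y → Y}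
    (hjA : IsResolventMap τ A jA) (hjB : IsResolventMap σ B jB) {zs : X × Y}
    (hzs : WithLp.toLp 2 zs ∈ zer (kkt K A B)) {z : ℕ → X × Y} {τs : ℕ → ℕ}
    (hτs : ∀ n, τs n ≠ 0) (hz : ∀ n, z (n + 1) = avgPDHG K τ σ jA jB (τs n) (z n)) (n : ℕ) :
    normM K τ σ (z n - zs) ≤ normM K τ σ (z 0 - zs) := by
  induction n with
  | zero => exact le_rfl
  | succ n ih =>
      rw [hz n]
      exact (normM_avgPDHG_sub_saddle_le K hτ hσ hK hA hB hjA hjB hzs _ (hτs n)).trans ih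

/-- **[ApplegateEtAl2022, Proposition 9] for restarted PDHG: the restart points stay in a bounded
region.** For the conic saddle on `C × D` (convex), any restart lengths `τ_n ≥ 1`, a feasible start
`z^{0,0} ∈ C × D` and any saddle point `z*`, every restart point lies in the `M`-ball
`W_R(z^{0,0}) ∩ (C × D)` with `R = 2‖z^{0,0} − z*‖_M` (the printed `R = 2 dist(z^{0,0}, Z*)` is the case
of the nearest saddle point). [cite: ApplegateEtAl2022, Proposition 9 (PDHG, R = 2 dist(z^{0,0}, Z*))] -/
theorem restart_mem_ballM [FiniteDimensional ℝ X] [FiniteDimensional ℝ Y] (K : X →L[ℝ] Y)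
    {C : Set X} {D : Set Y} (hC : Convex ℝ C) (hD : Convex ℝ D) {c : X} {b : Y} {τ σ : ℝ}
    (hτ : 0 < τ) (hσ : 0 < σ) (hK : τ * σ * ‖K‖ ^ 2 ≤ 1) {jA : X → X} {jB : Y → Y}
    (hjA : IsResolventMap τ (shiftOp c (normalCone C)) jA)
    (hjB : IsResolventMap σ (shiftOp b (normalCone D)) jB) {zs : X × Y}
    (hzs : zs ∈ saddleSet K C D c b) {z : ℕ → X × Y} {τs : ℕ → ℕ} (hτs : ∀ n, τs n ≠ 0)
    (hz : ∀ n, z (n + 1) = avgPDHG K τ σ jA jB (τs n) (z n)) (hz0 : (z 0).1 ∈ C ∧ (z 0).2 ∈ D)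
    (n : ℕ) : z n ∈ ballM K C D τ σ (z 0) (2 * normM K τ σ (z 0 - zs)) := by
  refine ⟨?_, ?_, ?_⟩
  · cases n with
    | zero => exact hz0.1
    | succ n => rw [hz n]; exact avgPDHG_fst_mem K hC hjA hjB _ (hτs n)
  · cases n with
    | zero => exact hz0.2
    | succ n => rw [hz n]; exact avgPDHG_snd_mem K hD hjA hjB _ (hτs n)
  · calc normM K τ σ (z n - z 0) ≤ normM K τ σ (z n - zs) + normM K τ σ (zs - z 0) :=
          normM_sub_le K hτ hσ hK _ _ _
      _ ≤ normM K τ σ (z 0 - zs) + normM K τ σ (z 0 - zs) := by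
          rw [normM_sub_rev K τ σ zs (z 0)]
          exact add_le_add (normM_restart_sub_saddle_le K hτ hσ hK
            (isMonotone_shiftOp c (isMonotone_normalCone C))
            (isMonotone_shiftOp b (isMonotone_normalCone D)) hjA hjB hzs hτs hz n) le_rfl
      _ = 2 * normM K τ σ (z 0 - zs) := by ring

/-- **[ApplegateEtAl2022, Proposition 9], distance form:** every radius `R > 2 dist_M(z^{0,0}, Z*)`
works — the restart points of restarted PDHG (any restart lengths) stay in `W_R(z^{0,0}) ∩ (C × D)`.
[cite: ApplegateEtAl2022, Proposition 9 (PDHG, R = 2 dist(z^{0,0}, Z*))] -/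
theorem restart_mem_ballM_of_lt [FiniteDimensional ℝ X] [FiniteDimensional ℝ Y] (K : X →L[ℝ] Y)
    {C : Set X} {D : Set Y} (hC : Convex ℝ C) (hD : Convex ℝ D) {c : X} {b : Y} {τ σ : ℝ}
    (hτ : 0 < τ) (hσ : 0 < σ) (hK : τ * σ * ‖K‖ ^ 2 ≤ 1) {jA : X → X} {jB : Y → Y}
    (hjA : IsResolventMap τ (shiftOp c (normalCone C)) jA)
    (hjB : IsResolventMap σ (shiftOp b (normalCone D)) jB) (hZ : (saddleSet K C D c b).Nonempty)
    {z : ℕ → X × Y} {τs : ℕ → ℕ} (hτs : ∀ n, τs n ≠ 0)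
    (hz : ∀ n, z (n + 1) = avgPDHG K τ σ jA jB (τs n) (z n)) (hz0 : (z 0).1 ∈ C ∧ (z 0).2 ∈ D)
    {R : ℝ} (hR : 2 * infDistM K τ σ (z 0) (saddleSet K C D c b) < R) (n : ℕ) :
    z n ∈ ballM K C D τ σ (z 0) R := by
  have hne : ((fun w => normM K τ σ (z 0 - w)) '' saddleSet K C D c b).Nonempty := hZ.image _
  have hlt : sInf ((fun w => normM K τ σ (z 0 - w)) '' saddleSet K C D c b) < R / 2 := by
    show infDistM K τ σ (z 0) (saddleSet K C D c b) < R / 2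
    linarith
  obtain ⟨_, ⟨zs, hzs, rfl⟩, hlt'⟩ := exists_lt_of_csInf_lt hne hlt
  obtain ⟨h1, h2, h3⟩ := restart_mem_ballM K hC hD hτ hσ hK hjA hjB hzs hτs hz hz0 n
  exact ⟨h1, h2, by linarith⟩

/-- The restart length `t* = ⌈4/(αβ)⌉` (any integer `t ≥ 4/(αβ)`) satisfies the hypothesis
`4/(αt) ≤ β` of Theorem 1. [cite: ApplegateEtAl2022, Theorem 1 (t* = ⌈2C(q+2)/(αβ)⌉, PDHG: C = 1 up to
the factor 2 of the step normalisation, q = 0)] -/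
theorem four_div_le_of_le_nat {α β : ℝ} (hα : 0 < α) (hβ : 0 < β) {t : ℕ}
    (ht : 4 / (α * β) ≤ (t : ℝ)) : 4 / (α * t) ≤ β := by
  have h0 : 0 < 4 / (α * β) := by positivity
  have ht' : (0 : ℝ) < t := h0.trans_le ht
  rw [div_le_iff₀ (by positivity)] at ht ⊢
  nlinarith

/-- `⌈4/(αβ)⌉ ≥ 1`. [cite: ApplegateEtAl2022, Theorem 1 (t*)] -/
theorem ceil_restart_ne_zero {α β : ℝ} (hα : 0 < α) (hβ : 0 < β) : ⌈4 / (α * β)⌉₊ ≠ 0 := by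
  have h0 : 0 < 4 / (α * β) := by positivity
  exact Nat.pos_iff_ne_zero.mp (Nat.ceil_pos.mpr h0)

/-- From `log(d₀/ε) ≤ n log(1/β)` to `βⁿ d₀ ≤ ε` (`d₀ ≥ 0`, `ε > 0`, `0 ≤ β`).
[cite: ApplegateEtAl2022, Remark 3 (O((C/α) log(1/ε)) iterations)] -/
theorem pow_mul_le_of_log_le {β d₀ ε : ℝ} (hβ0 : 0 ≤ β) (hd : 0 ≤ d₀) (hε : 0 < ε)
    {n : ℕ} (hn : Real.log (d₀ / ε) ≤ n * Real.log (1 / β)) : β ^ n * d₀ ≤ ε := by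
  rcases eq_or_lt_of_le hd with h0 | hdpos
  · rw [← h0, mul_zero]; exact hε.le
  rcases eq_or_lt_of_le hβ0 with hb | hbpos
  · -- `β = 0`: then `log(1/β) = 0`, so `d₀ ≤ ε`, and `βⁿ ≤ 1`
    rw [← hb] at hn ⊢
    simp only [div_zero, Real.log_zero, mul_zero] at hn
    have hle : d₀ ≤ ε := by
      have h := (Real.log_nonpos_iff (by positivity)).mp hn
      rwa [div_le_one hε] at h
    have hpow : (0 : ℝ) ^ n ≤ 1 := pow_le_one₀ le_rfl zero_le_one
    nlinarith
  · have hβn : 0 < β ^ n := pow_pos hbpos n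
    rw [← Real.log_le_log_iff (mul_pos hβn hdpos) hε, Real.log_mul hβn.ne' hdpos.ne',
      Real.log_pow]
    rw [Real.log_div hdpos.ne' hε.ne', one_div, Real.log_inv] at hn
    linarith

/-- **[ApplegateEtAl2022, Remark 3] for restarted PDHG: `O((1/α) log(1/ε))` iterations.** In the
setting of Theorem 1 (`infDistM_iterate_avgPDHG_le_pow`), `n` restarts with
`log(dist_M(z^{0,0}, Z*)/ε) ≤ n log(1/β)` already give `dist_M(z^{n,0}, Z*) ≤ ε`.
[cite: ApplegateEtAl2022, Remark 3] -/
theorem infDistM_iterate_avgPDHG_le_of_log_le [FiniteDimensional ℝ X] [FiniteDimensional ℝ Y]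
    (K : X →L[ℝ] Y) {C : Set X} {D : Set Y} (hC : Convex ℝ C) (hD : Convex ℝ D) (c : X) (b : Y)
    {τ σ : ℝ} (hτ : 0 < τ) (hσ : 0 < σ) (hK : τ * σ * ‖K‖ ^ 2 ≤ 1) {jA : X → X} {jB : Y → Y}
    (hjA : IsResolventMap τ (shiftOp c (normalCone C)) jA)
    (hjB : IsResolventMap σ (shiftOp b (normalCone D)) jB)
    (hZ : (saddleSet K C D c b).Nonempty) {t : ℕ} (ht : t ≠ 0) {α β : ℝ} (hα : 0 < α)
    (hβ0 : 0 ≤ β) (hβ1 : β < 1) (htstar : 4 / (α * t) ≤ β) {z₀ : X × Y}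
    (hz₀ : z₀.1 ∈ C ∧ z₀.2 ∈ D)
    (hsharp : IsSharpOn K C D c b τ σ
      (ballM K C D τ σ z₀ (2 / (1 - β) * infDistM K τ σ z₀ (saddleSet K C D c b))) α)
    {ε : ℝ} (hε : 0 < ε) {n : ℕ}
    (hn : Real.log (infDistM K τ σ z₀ (saddleSet K C D c b) / ε) ≤ n * Real.log (1 / β)) :
    infDistM K τ σ ((avgPDHG K τ σ jA jB t)^[n] z₀) (saddleSet K C D c b) ≤ ε :=
  infDistM_iterate_avgPDHG_le_of_pow_le K hC hD c b hτ hσ hK hjA hjB hZ ht hα hβ0 hβ1 htstar hz₀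
    hsharp (pow_mul_le_of_log_le hβ0 (infDistM_nonneg K τ σ _ _) hε hn)

/-- **Total work of fixed-frequency restarted PDHG** ([ApplegateEtAl2022, Theorem 1 + Remark 3],
PDHG row of Table 1): with the restart length `t* = ⌈4/(αβ)⌉` (so that `4/(αt*) ≤ β` holds
automatically) and `n ≥ log(dist_M(z^{0,0}, Z*)/ε)/log(1/β)` restarts — i.e. `n · ⌈4/(αβ)⌉` PDHG
iterations in total — the restart point is within `M`-distance `ε` of the saddle set.
[cite: ApplegateEtAl2022, Theorem 1 with Remark 3 (O((C/α) log(1/ε)))] -/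
theorem infDistM_iterate_avgPDHG_ceil_le [FiniteDimensional ℝ X] [FiniteDimensional ℝ Y]
    (K : X →L[ℝ] Y) {C : Set X} {D : Set Y} (hC : Convex ℝ C) (hD : Convex ℝ D) (c : X) (b : Y)
    {τ σ : ℝ} (hτ : 0 < τ) (hσ : 0 < σ) (hK : τ * σ * ‖K‖ ^ 2 ≤ 1) {jA : X → X} {jB : Y → Y}
    (hjA : IsResolventMap τ (shiftOp c (normalCone C)) jA)
    (hjB : IsResolventMap σ (shiftOp b (normalCone D)) jB)
    (hZ : (saddleSet K C D c b).Nonempty) {α β : ℝ} (hα : 0 < α) (hβ0 : 0 < β) (hβ1 : β < 1)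
    {z₀ : X × Y} (hz₀ : z₀.1 ∈ C ∧ z₀.2 ∈ D)
    (hsharp : IsSharpOn K C D c b τ σ
      (ballM K C D τ σ z₀ (2 / (1 - β) * infDistM K τ σ z₀ (saddleSet K C D c b))) α)
    {ε : ℝ} (hε : 0 < ε) {n : ℕ}
    (hn : Real.log (infDistM K τ σ z₀ (saddleSet K C D c b) / ε) ≤ n * Real.log (1 / β)) :
    infDistM K τ σ ((avgPDHG K τ σ jA jB ⌈4 / (α * β)⌉₊)^[n] z₀) (saddleSet K C D c b) ≤ ε :=
  infDistM_iterate_avgPDHG_le_of_log_le K hC hD c b hτ hσ hK hjA hjB hZ (ceil_restart_ne_zero hα hβ0)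
    hα hβ0.le hβ1 (four_div_le_of_le_nat hα hβ0 (Nat.le_ceil _)) hz₀ hsharp hε hn

/-! ### Basic properties of the normalized duality gap ([ApplegateEtAl2022, §3: Fact 1, Fact 2,
Proposition 5, Proposition 6]) -/

omit [CompleteSpace X] [CompleteSpace Y] in
/-- The gap against a displaced point, without adjoints:
`G(z; ζ) = ⟨Kx − b, (ζ − z)_y⟩ − ⟨c, (ζ − z)_x⟩ − ⟨K(ζ − z)_x, y⟩` (bilinearity of `L`).
[cite: ApplegateEtAl2022, §3.2 (17) (L(x,ŷ) − L(x̂,y) = F(z)ᵀ(z − ẑ))] -/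
theorem gap_eq_inner_displacement (K : X →L[ℝ] Y) (c : X) (b : Y)
    (z ζ : X × Y) :
    gap K c b z ζ = ⟪K z.1 - b, (ζ - z).2⟫ - ⟪c, (ζ - z).1⟫ - ⟪K (ζ - z).1, z.2⟫ := by
  unfold gap conicL
  simp only [Prod.snd_sub, Prod.fst_sub, inner_sub_left, inner_sub_right, map_sub]
  ring

/-- On an `M`-ball the displacement has controlled Euclidean components (`τσ‖K‖² < 1`):
`‖(ζ − z)_x‖ ≤ √(τ/(1 − √(τσ)‖K‖)) · r` and `‖(ζ − z)_y‖ ≤ √(σ/(1 − √(τσ)‖K‖)) · r`.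
[cite: ApplegateEtAl2022, §3 (display after the remark following Definition 1: ‖·‖_M ≍ ‖·‖₂)] -/
theorem norm_fst_snd_le_of_normM_le (K : X →L[ℝ] Y) {τ σ : ℝ} (hτ : 0 < τ) (hσ : 0 < σ)
    (hK : τ * σ * ‖K‖ ^ 2 < 1) {d : X × Y} {r : ℝ} (hd : normM K τ σ d ≤ r) :
    ‖d.1‖ ≤ Real.sqrt (τ / (1 - Real.sqrt (τ * σ) * ‖K‖)) * r ∧
      ‖d.2‖ ≤ Real.sqrt (σ / (1 - Real.sqrt (τ * σ) * ‖K‖)) * r := by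
  have hθ : Real.sqrt (τ * σ) * ‖K‖ < 1 := by
    have h1 : (Real.sqrt (τ * σ) * ‖K‖) ^ 2 < 1 := by
      rw [mul_pow, Real.sq_sqrt (by positivity)]; linarith
    have h0 : 0 ≤ Real.sqrt (τ * σ) * ‖K‖ := by positivity
    nlinarith
  set θ := 1 - Real.sqrt (τ * σ) * ‖K‖ with hθdef
  have hθ0 : 0 < θ := by rw [hθdef]; linarith
  have hr : 0 ≤ r := (normM_nonneg K τ σ d).trans hd
  have hE := euclidean_le_normM_sq K hτ hσ hK.le d
  have hM2 : normM K τ σ d ^ 2 ≤ r ^ 2 := pow_le_pow_left₀ (normM_nonneg K τ σ d) hd 2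
  have h1 : ‖d.1‖ ^ 2 ≤ τ / θ * r ^ 2 := by
    rw [div_mul_eq_mul_div, le_div_iff₀ hθ0]
    have : θ * (τ⁻¹ * ‖d.1‖ ^ 2) ≤ r ^ 2 := by
      have h := hE.trans hM2
      nlinarith [mul_nonneg hθ0.le (mul_nonneg (inv_nonneg.mpr hσ.le) (sq_nonneg ‖d.2‖))]
    calc ‖d.1‖ ^ 2 * θ = τ * (θ * (τ⁻¹ * ‖d.1‖ ^ 2)) := by field_simp
      _ ≤ τ * r ^ 2 := mul_le_mul_of_nonneg_left this hτ.le
  have h2 : ‖d.2‖ ^ 2 ≤ σ / θ * r ^ 2 := by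
    rw [div_mul_eq_mul_div, le_div_iff₀ hθ0]
    have : θ * (σ⁻¹ * ‖d.2‖ ^ 2) ≤ r ^ 2 := by
      have h := hE.trans hM2
      nlinarith [mul_nonneg hθ0.le (mul_nonneg (inv_nonneg.mpr hτ.le) (sq_nonneg ‖d.1‖))]
    calc ‖d.2‖ ^ 2 * θ = σ * (θ * (σ⁻¹ * ‖d.2‖ ^ 2)) := by field_simp
      _ ≤ σ * r ^ 2 := mul_le_mul_of_nonneg_left this hσ.le
  constructor
  · have h : ‖d.1‖ ^ 2 ≤ (Real.sqrt (τ / θ) * r) ^ 2 := by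
      rw [mul_pow, Real.sq_sqrt (by positivity)]; exact h1
    exact (pow_le_pow_iff_left₀ (norm_nonneg _) (by positivity) two_ne_zero).mp h
  · have h : ‖d.2‖ ^ 2 ≤ (Real.sqrt (σ / θ) * r) ^ 2 := by
      rw [mul_pow, Real.sq_sqrt (by positivity)]; exact h2
    exact (pow_le_pow_iff_left₀ (norm_nonneg _) (by positivity) two_ne_zero).mp h

/-- The gap set over an `M`-ball is bounded above when `τσ‖K‖² < 1` (the localized duality gap
`ρ_r(z)` is then a genuine supremum). [cite: ApplegateEtAl2022, §1 (4) (ρ_r is well defined on bounded balls)] -/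
theorem bddAbove_gap_ball (K : X →L[ℝ] Y) (C : Set X) (D : Set Y)
    (c : X) (b : Y) {τ σ : ℝ} (hτ : 0 < τ) (hσ : 0 < σ) (hK : τ * σ * ‖K‖ ^ 2 < 1) (z : X × Y)
    (r : ℝ) :
    BddAbove ((fun ζ => gap K c b z ζ) '' {ζ : X × Y | ζ.1 ∈ C ∧ ζ.2 ∈ D ∧ normM K τ σ (ζ - z) ≤ r}) := by
  set ax := Real.sqrt (τ / (1 - Real.sqrt (τ * σ) * ‖K‖)) with hax
  set ay := Real.sqrt (σ / (1 - Real.sqrt (τ * σ) * ‖K‖)) with hay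
  refine ⟨‖K z.1 - b‖ * (ay * |r|) + ‖c‖ * (ax * |r|) + ‖K‖ * (ax * |r|) * ‖z.2‖, ?_⟩
  rintro _ ⟨ζ, ⟨-, -, hζ⟩, rfl⟩
  show gap K c b z ζ ≤ _
  rw [gap_eq_inner_displacement]
  obtain ⟨h1, h2⟩ := norm_fst_snd_le_of_normM_le K hτ hσ hK hζ
  have h1' : ‖(ζ - z).1‖ ≤ ax * |r| :=
    h1.trans (mul_le_mul_of_nonneg_left (le_abs_self r) (Real.sqrt_nonneg _))
  have h2' : ‖(ζ - z).2‖ ≤ ay * |r| :=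
    h2.trans (mul_le_mul_of_nonneg_left (le_abs_self r) (Real.sqrt_nonneg _))
  have i1 : ⟪K z.1 - b, (ζ - z).2⟫ ≤ ‖K z.1 - b‖ * (ay * |r|) :=
    (real_inner_le_norm _ _).trans (mul_le_mul_of_nonneg_left h2' (norm_nonneg _))
  have i2 : -⟪c, (ζ - z).1⟫ ≤ ‖c‖ * (ax * |r|) := by
    rw [← inner_neg_right]
    refine (real_inner_le_norm _ _).trans ?_
    rw [norm_neg]
    exact mul_le_mul_of_nonneg_left h1' (norm_nonneg _)
  have i3 : -⟪K (ζ - z).1, z.2⟫ ≤ ‖K‖ * (ax * |r|) * ‖z.2‖ := by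
    rw [← inner_neg_left]
    refine (real_inner_le_norm _ _).trans ?_
    rw [norm_neg]
    refine mul_le_mul_of_nonneg_right ?_ (norm_nonneg _)
    exact (K.le_opNorm _).trans (mul_le_mul_of_nonneg_left h1' (norm_nonneg _))
  linarith

/-- `ρ_r(z) ≥ 0` at feasible `z` (`r > 0`, `τσ‖K‖² < 1`): the test point `ẑ = z` has gap `0`.
[cite: ApplegateEtAl2022, §1 (4) with Proposition 6 (0 ≤ ρ_r(z))] -/
theorem rho_nonneg (K : X →L[ℝ] Y) {C : Set X} {D : Set Y}
    (c : X) (b : Y) {τ σ : ℝ} (hτ : 0 < τ) (hσ : 0 < σ) (hK : τ * σ * ‖K‖ ^ 2 < 1) {z : X × Y}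
    (hz1 : z.1 ∈ C) (hz2 : z.2 ∈ D) {r : ℝ} (hr : 0 < r) : 0 ≤ rho K C D c b τ σ r z := by
  unfold rho
  refine mul_nonneg (inv_nonneg.mpr hr.le) ?_
  have h : gap K c b z z ≤ _ := le_csSup (bddAbove_gap_ball K C D c b hτ hσ hK z r)
    ⟨z, ⟨hz1, hz2, by rw [sub_self, normM_zero]; exact hr.le⟩, rfl⟩
  rwa [gap_self] at h

/-- **[ApplegateEtAl2022, Fact 1]: `r ↦ r ρ_r(z)` is non-decreasing** (on `r > 0`, at feasible `z`): the
supremum is taken over a larger ball. [cite: ApplegateEtAl2022, Fact 1] -/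
theorem mul_rho_mono (K : X →L[ℝ] Y) {C : Set X} {D : Set Y}
    (c : X) (b : Y) {τ σ : ℝ} (hτ : 0 < τ) (hσ : 0 < σ) (hK : τ * σ * ‖K‖ ^ 2 < 1) {z : X × Y}
    (hz1 : z.1 ∈ C) (hz2 : z.2 ∈ D) {r₁ r₂ : ℝ} (hr₁ : 0 < r₁) (h12 : r₁ ≤ r₂) :
    r₁ * rho K C D c b τ σ r₁ z ≤ r₂ * rho K C D c b τ σ r₂ z := by
  have hr₂ : 0 < r₂ := hr₁.trans_le h12
  unfold rho
  rw [← mul_assoc, mul_inv_cancel₀ hr₁.ne', one_mul, ← mul_assoc, mul_inv_cancel₀ hr₂.ne', one_mul]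
  refine csSup_le ⟨_, ⟨z, ⟨hz1, hz2, by rw [sub_self, normM_zero]; exact hr₁.le⟩, rfl⟩⟩ ?_
  rintro _ ⟨ζ, ⟨hζ1, hζ2, hζ⟩, rfl⟩
  exact le_csSup (bddAbove_gap_ball K C D c b hτ hσ hK z r₂) ⟨ζ, ⟨hζ1, hζ2, hζ.trans h12⟩, rfl⟩

/-- **[ApplegateEtAl2022, Proposition 5]: `ρ_r(z)` is non-increasing in `r`** (`0 < r₁ ≤ r₂`, `z`
feasible, `C`, `D` convex): shrink a test point of the `r₂`-ball towards `z` by the factor `r₁/r₂`;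
by convex–concavity (here: bilinearity, `gap_add_smul_sub`) its gap shrinks by at most that factor.
[cite: ApplegateEtAl2022, Proposition 5] -/
theorem rho_antitone (K : X →L[ℝ] Y) {C : Set X} {D : Set Y}
    (hC : Convex ℝ C) (hD : Convex ℝ D) (c : X) (b : Y) {τ σ : ℝ} (hτ : 0 < τ) (hσ : 0 < σ)
    (hK : τ * σ * ‖K‖ ^ 2 < 1) {z : X × Y} (hz1 : z.1 ∈ C) (hz2 : z.2 ∈ D) {r₁ r₂ : ℝ}
    (hr₁ : 0 < r₁) (h12 : r₁ ≤ r₂) :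
    rho K C D c b τ σ r₂ z ≤ rho K C D c b τ σ r₁ z := by
  have hr₂ : 0 < r₂ := hr₁.trans_le h12
  set S₁ := (fun ζ => gap K c b z ζ) '' {ζ : X × Y | ζ.1 ∈ C ∧ ζ.2 ∈ D ∧ normM K τ σ (ζ - z) ≤ r₁}
    with hS₁
  have hbdd₁ : BddAbove S₁ := bddAbove_gap_ball K C D c b hτ hσ hK z r₁
  have h0 : 0 ≤ sSup S₁ := by
    have h : gap K c b z z ≤ sSup S₁ :=
      le_csSup hbdd₁ ⟨z, ⟨hz1, hz2, by rw [sub_self, normM_zero]; exact hr₁.le⟩, rfl⟩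
    rwa [gap_self] at h
  -- every gap over the `r₂`-ball is `≤ (r₂/r₁) sup₁`
  have hmain : sSup ((fun ζ => gap K c b z ζ) ''
      {ζ : X × Y | ζ.1 ∈ C ∧ ζ.2 ∈ D ∧ normM K τ σ (ζ - z) ≤ r₂}) ≤ r₂ / r₁ * sSup S₁ := by
    refine csSup_le ⟨_, ⟨z, ⟨hz1, hz2, by rw [sub_self, normM_zero]; exact hr₂.le⟩, rfl⟩⟩ ?_
    rintro _ ⟨ζ, ⟨hζ1, hζ2, hζ⟩, rfl⟩
    show gap K c b z ζ ≤ _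
    set s := r₁ / r₂ with hs
    have hs0 : 0 < s := div_pos hr₁ hr₂
    have hs1 : s ≤ 1 := (div_le_one hr₂).mpr h12
    have hmem : gap K c b z (z + s • (ζ - z)) ∈ S₁ := by
      refine ⟨z + s • (ζ - z), ⟨?_, ?_, ?_⟩, rfl⟩
      · have e : (z + s • (ζ - z)).1 = (1 - s) • z.1 + s • ζ.1 := by
          simp only [Prod.fst_add, Prod.smul_fst, Prod.fst_sub, smul_sub, sub_smul, one_smul]; abel
        rw [e]; exact hC hz1 hζ1 (by linarith) hs0.le (by ring)
      · have e : (z + s • (ζ - z)).2 = (1 - s) • z.2 + s • ζ.2 := by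
          simp only [Prod.snd_add, Prod.smul_snd, Prod.snd_sub, smul_sub, sub_smul, one_smul]; abel
        rw [e]; exact hD hz2 hζ2 (by linarith) hs0.le (by ring)
      · rw [add_sub_cancel_left, normM_smul, abs_of_pos hs0]
        calc s * normM K τ σ (ζ - z) ≤ s * r₂ := mul_le_mul_of_nonneg_left hζ hs0.le
          _ = r₁ := by rw [hs]; field_simp
    have h := le_csSup hbdd₁ hmem
    rw [gap_add_smul_sub] at h
    -- `s G ≤ sup₁` ⇒ `G ≤ sup₁ / s = (r₂/r₁) sup₁`
    rw [div_mul_eq_mul_div, le_div_iff₀ hr₁]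
    calc gap K c b z ζ * r₁ = r₂ * (s * gap K c b z ζ) := by rw [hs]; field_simp
      _ ≤ r₂ * sSup S₁ := mul_le_mul_of_nonneg_left h hr₂.le
  unfold rho
  calc r₂⁻¹ * sSup ((fun ζ => gap K c b z ζ) ''
        {ζ : X × Y | ζ.1 ∈ C ∧ ζ.2 ∈ D ∧ normM K τ σ (ζ - z) ≤ r₂})
      ≤ r₂⁻¹ * (r₂ / r₁ * sSup S₁) := mul_le_mul_of_nonneg_left hmain (inv_nonneg.mpr hr₂.le)
    _ = r₁⁻¹ * sSup S₁ := by field_simp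

/-- **[ApplegateEtAl2022, Proposition 6]: `ρ_r(z) = 0` iff `z` is a saddle point** (`z` feasible,
`r > 0`, `C`, `D` convex, `τσ‖K‖² < 1`): "the normalized duality gap is zero if and only if the
primal-dual gap is zero". (⇐: every gap at a saddle point is `≤ 0`; ⇒: a positive gap against some
feasible `ẑ` survives shrinking `ẑ` into the `r`-ball.) [cite: ApplegateEtAl2022, Proposition 6] -/
theorem rho_eq_zero_iff_mem_saddleSet (K : X →L[ℝ] Y)
    {C : Set X} {D : Set Y} (hC : Convex ℝ C) (hD : Convex ℝ D) (c : X) (b : Y) {τ σ : ℝ}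
    (hτ : 0 < τ) (hσ : 0 < σ) (hK : τ * σ * ‖K‖ ^ 2 < 1) {z : X × Y} (hz1 : z.1 ∈ C)
    (hz2 : z.2 ∈ D) {r : ℝ} (hr : 0 < r) :
    rho K C D c b τ σ r z = 0 ↔ z ∈ saddleSet K C D c b := by
  set S := (fun ζ => gap K c b z ζ) '' {ζ : X × Y | ζ.1 ∈ C ∧ ζ.2 ∈ D ∧ normM K τ σ (ζ - z) ≤ r}
    with hS
  have hbdd : BddAbove S := bddAbove_gap_ball K C D c b hτ hσ hK z r
  have hzS : gap K c b z z ∈ S := ⟨z, ⟨hz1, hz2, by rw [sub_self, normM_zero]; exact hr.le⟩, rfl⟩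
  have hρ : rho K C D c b τ σ r z = r⁻¹ * sSup S := rfl
  constructor
  · intro h0
    have hsup : sSup S = 0 := by
      have h1 : r⁻¹ * sSup S = 0 := by rw [← hρ, h0]
      rcases mul_eq_zero.mp h1 with h | h
      · exact absurd h (inv_ne_zero hr.ne')
      · exact h
    -- every feasible `ζ` has `gap(z; ζ) ≤ 0`
    have hgap : ∀ ζ : X × Y, ζ.1 ∈ C → ζ.2 ∈ D → gap K c b z ζ ≤ 0 := by
      intro ζ hζ1 hζ2
      by_cases hn : normM K τ σ (ζ - z) ≤ r
      · have h := le_csSup hbdd ⟨ζ, ⟨hζ1, hζ2, hn⟩, rfl⟩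
        rwa [hsup] at h
      · push Not at hn
        have hpos : 0 < normM K τ σ (ζ - z) := hr.trans hn
        set s := r / normM K τ σ (ζ - z) with hs
        have hs0 : 0 < s := div_pos hr hpos
        have hs1 : s ≤ 1 := (div_le_one hpos).mpr hn.le
        have hmem : gap K c b z (z + s • (ζ - z)) ∈ S := by
          refine ⟨z + s • (ζ - z), ⟨?_, ?_, ?_⟩, rfl⟩
          · have e : (z + s • (ζ - z)).1 = (1 - s) • z.1 + s • ζ.1 := by
              simp only [Prod.fst_add, Prod.smul_fst, Prod.fst_sub, smul_sub, sub_smul, one_smul]; abel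
            rw [e]; exact hC hz1 hζ1 (by linarith) hs0.le (by ring)
          · have e : (z + s • (ζ - z)).2 = (1 - s) • z.2 + s • ζ.2 := by
              simp only [Prod.snd_add, Prod.smul_snd, Prod.snd_sub, smul_sub, sub_smul, one_smul]; abel
            rw [e]; exact hD hz2 hζ2 (by linarith) hs0.le (by ring)
          · rw [add_sub_cancel_left, normM_smul, abs_of_pos hs0, hs, div_mul_cancel₀ r hpos.ne']
        have h := le_csSup hbdd hmem
        rw [gap_add_smul_sub, hsup] at h
        -- `s G ≤ 0` with `s > 0`
        by_contra hG
        push Not at hG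
        linarith [mul_pos hs0 hG]
    rw [mem_saddleSet_iff]
    refine ⟨hz1, hz2, fun x hx => ?_, fun y hy => ?_⟩
    · have h := hgap (x, z.2) hx hz2
      unfold gap at h
      linarith
    · have h := hgap (z.1, y) hz1 hy
      unfold gap at h
      linarith
  · intro hz
    obtain ⟨-, -, hmin, hmax⟩ := (mem_saddleSet_iff K C D c b z).mp hz
    have hsup : sSup S ≤ 0 := by
      refine csSup_le ⟨_, hzS⟩ ?_
      rintro _ ⟨ζ, ⟨hζ1, hζ2, -⟩, rfl⟩
      show gap K c b z ζ ≤ 0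
      unfold gap
      linarith [hmin ζ.1 hζ1, hmax ζ.2 hζ2]
    have hsup0 : 0 ≤ sSup S := by
      have h := le_csSup hbdd hzS
      rwa [gap_self] at h
    rw [hρ, le_antisymm hsup hsup0, mul_zero]

/-- Subsets of an `M`-ball have bounded `M`-diameter data and `diam S₁ ≤ diam W_R(z⁰)`.
[cite: ApplegateEtAl2022, Fact 2 (with §1 Notation diam)] -/
theorem diamM_mono_ballM (K : X →L[ℝ] Y) {C : Set X} {D : Set Y} {τ σ : ℝ} (hτ : 0 < τ)
    (hσ : 0 < σ) (hK : τ * σ * ‖K‖ ^ 2 ≤ 1) (z₀ : X × Y) (R : ℝ) {S₁ : Set (X × Y)}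
    (hS : S₁ ⊆ ballM K C D τ σ z₀ R) :
    diamM K τ σ S₁ ≤ diamM K τ σ (ballM K C D τ σ z₀ R) := by
  rcases S₁.eq_empty_or_nonempty with h | hne
  · -- empty set: `diam ∅ = 0 ≤ diam W`
    have h0 : diamM K τ σ S₁ = 0 := by
      unfold diamM; rw [h, Set.empty_prod, Set.image_empty, Real.sSup_empty]
    rw [h0]
    unfold diamM
    refine Real.sSup_nonneg ?_
    rintro _ ⟨p, -, rfl⟩
    exact normM_nonneg K τ σ _
  · obtain ⟨u, hu⟩ := hne
    refine csSup_le ⟨_, ⟨(u, u), Set.mk_mem_prod hu hu, rfl⟩⟩ ?_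
    rintro _ ⟨p, hp, rfl⟩
    obtain ⟨hp1, hp2⟩ := Set.mem_prod.mp hp
    exact normM_sub_le_diamM_ballM K hτ hσ hK z₀ R (hS hp1) (hS hp2)

/-- **[ApplegateEtAl2022, Fact 2]: sharpness is monotone in the set.** If the problem is `α`-sharp on
the feasible ball `W_R(z⁰)` then it is `α`-sharp on every subset `S₁ ⊆ W_R(z⁰)`.
[cite: ApplegateEtAl2022, Fact 2] -/
theorem IsSharpOn.mono_ballM (K : X →L[ℝ] Y) {C : Set X} {D : Set Y} (c : X) (b : Y) {τ σ : ℝ}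
    (hτ : 0 < τ) (hσ : 0 < σ) (hK : τ * σ * ‖K‖ ^ 2 ≤ 1) (z₀ : X × Y) (R : ℝ) {α : ℝ}
    {S₁ : Set (X × Y)} (hS : S₁ ⊆ ballM K C D τ σ z₀ R)
    (h : IsSharpOn K C D c b τ σ (ballM K C D τ σ z₀ R) α) : IsSharpOn K C D c b τ σ S₁ α :=
  fun z hz r hr hrd => h z (hS hz) r hr (hrd.trans (diamM_mono_ballM K hτ hσ hK z₀ R hS))

/-! ### Sharpness with slack: [XiongFreund2024, Theorem 3.5] for restarted PDHG

Z. Xiong, R. M. Freund, *The role of level-set geometry on the performance of PDHG for conic linear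
optimization*, arXiv:2406.01942 (2024), §3.2, Theorem 3.5 (pp. 18–20, read at the page). The printed
statement is for restarted PDHG (their Algorithm 2 with the `β`-restart condition (3.1) = the adaptive
scheme above) under the RELAXED sharpness hypothesis (3.19)
`Dist_M(z^{n,0}, Z*) ≤ L · ρ(‖z^{n,0} − z^{n−1,0}‖_M; z^{n,0}) + C` for all `n ≥ 1`; conclusion (3.20):
the total number `T` of PDHG steps run before the first restart value with
`ρ(‖z^{N,0} − z^{N−1,0}‖_M; z^{N,0}) ≤ ε` obeys `T ≤ 23L·ln(23 Dist_M(z^{0,0}, Z*)/ε) + 35C/ε` (`β = 1/e`,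
first inner length `k_0 = 1`, their Property-3 constant `8` from [XiongFreund2024, Lemma 2.4]). Typed
here with general `β ∈ (0, 1)`, a free first length `τ_0`, and this file's Property-3 constants
(`ρ_r(z̄ᵗ) ≤ 2r/t`, `‖z̄ᵗ − z⁰‖_M ≤ 2 dist_M(z⁰, Z*)`, i.e. `4` for the paper's `8`); the bookkeeping is
`PrimalDualRestartSharpness.sum_lengths_le` / `sum_inv_potential_le`. -/

/-- **The adaptive restart criterion under sharpness with slack (PDHG)** — the inner-loop bound
(3.21)–(3.24) of [XiongFreund2024, Theorem 3.5]: if the restart point `z^{n,0}` satisfies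
`dist_M(z^{n,0}, Z*) ≤ L·g + C'` with `g = ρ_{‖z^{n,0} − z^{n−1,0}‖}(z^{n,0})` (their (3.19)), then the
adaptive condition `ρ_{‖z̄ − z^{n,0}‖}(z̄) ≤ β·g` holds for `z̄ = z̄^{t₁}(z^{n,0})` as soon as
`4(L g + C') ≤ β g t₁` (Property 3 (i) and (ii): `ρ_{‖z̄ − z^{n,0}‖}(z̄) ≤ 4 dist_M(z^{n,0}, Z*)/t₁`).
[cite: XiongFreund2024, Theorem 3.5 (proof, (3.21)–(3.24))] -/
theorem adaptive_condition_avgPDHG_of_slack [FiniteDimensional ℝ X] [FiniteDimensional ℝ Y]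
    (K : X →L[ℝ] Y) {C : Set X} {D : Set Y} (hC : Convex ℝ C) (hD : Convex ℝ D) (c : X) (b : Y)
    {τ σ : ℝ} (hτ : 0 < τ) (hσ : 0 < σ) (hK : τ * σ * ‖K‖ ^ 2 ≤ 1) {jA : X → X} {jB : Y → Y}
    (hjA : IsResolventMap τ (shiftOp c (normalCone C)) jA)
    (hjB : IsResolventMap σ (shiftOp b (normalCone D)) jB)
    (hZ : (saddleSet K C D c b).Nonempty) {zprev zn : X × Y} {β L C' : ℝ}
    (hslack : infDistM K τ σ zn (saddleSet K C D c b) ≤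
      L * rho K C D c b τ σ (normM K τ σ (zn - zprev)) zn + C')
    {t₁ : ℕ} (ht₁ : t₁ ≠ 0)
    (ht : 4 * (L * rho K C D c b τ σ (normM K τ σ (zn - zprev)) zn + C') ≤
      β * rho K C D c b τ σ (normM K τ σ (zn - zprev)) zn * t₁) :
    rho K C D c b τ σ (normM K τ σ (avgPDHG K τ σ jA jB t₁ zn - zn)) (avgPDHG K τ σ jA jB t₁ zn) ≤
      β * rho K C D c b τ σ (normM K τ σ (zn - zprev)) zn := by
  have ht₁' : (0 : ℝ) < t₁ := Nat.cast_pos.mpr (Nat.pos_of_ne_zero ht₁)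
  set Zs := saddleSet K C D c b with hZs
  set g := rho K C D c b τ σ (normM K τ σ (zn - zprev)) zn with hg
  set zb := avgPDHG K τ σ jA jB t₁ zn with hzb
  set r' := normM K τ σ (zb - zn) with hr'
  -- Property 3 (i) at `z^{n,0}` with inner length `t₁`, and Property 3 (ii)
  have hP3a : rho K C D c b τ σ r' zb ≤ 2 * r' / t₁ :=
    rho_avgPDHG_le K hC hD c b hτ hσ hK hjA hjB zn ht₁
  have hP3b : r' ≤ 2 * infDistM K τ σ zn Zs :=
    normM_avgPDHG_sub_le_infDistM K c b hτ hσ hK hjA hjB hZ zn ht₁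
  have h1 : 2 * r' / t₁ ≤ 2 * (2 * (L * g + C')) / t₁ :=
    div_le_div_of_nonneg_right (by linarith [hP3b, hslack]) ht₁'.le
  have h2 : 2 * (2 * (L * g + C')) / t₁ ≤ β * g := by
    rw [div_le_iff₀ ht₁']
    linarith [ht]
  exact hP3a.trans (h1.trans h2)

/-- **Inner-loop length under sharpness with slack (PDHG)** [XiongFreund2024, Theorem 3.5 (proof,
(3.24))]: with first-hit adaptive restarts, the restart from `z^{n,0}` happens at an inner length
`τ_n ≤ t₁` for every `t₁ ≥ 1` with `4(L g + C') ≤ β g t₁` (`g` the previous potential), i.e.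
`τ_n ≤ ⌊4(L + C'/g)/β⌋ + 1` when `g > 0`. [cite: XiongFreund2024, Theorem 3.5 (proof, (3.24))] -/
theorem adaptive_length_avgPDHG_le_of_slack [FiniteDimensional ℝ X] [FiniteDimensional ℝ Y]
    (K : X →L[ℝ] Y) {C : Set X} {D : Set Y} (hC : Convex ℝ C) (hD : Convex ℝ D) (c : X) (b : Y)
    {τ σ : ℝ} (hτ : 0 < τ) (hσ : 0 < σ) (hK : τ * σ * ‖K‖ ^ 2 ≤ 1) {jA : X → X} {jB : Y → Y}
    (hjA : IsResolventMap τ (shiftOp c (normalCone C)) jA)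
    (hjB : IsResolventMap σ (shiftOp b (normalCone D)) jB)
    (hZ : (saddleSet K C D c b).Nonempty) {zprev zn : X × Y} {β L C' : ℝ}
    (hslack : infDistM K τ σ zn (saddleSet K C D c b) ≤
      L * rho K C D c b τ σ (normM K τ σ (zn - zprev)) zn + C')
    {τn : ℕ}
    (hfirst : ∀ t : ℕ, t ≠ 0 → t < τn →
      ¬ rho K C D c b τ σ (normM K τ σ (avgPDHG K τ σ jA jB t zn - zn)) (avgPDHG K τ σ jA jB t zn) ≤
        β * rho K C D c b τ σ (normM K τ σ (zn - zprev)) zn)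
    {t₁ : ℕ} (ht₁ : t₁ ≠ 0)
    (ht : 4 * (L * rho K C D c b τ σ (normM K τ σ (zn - zprev)) zn + C') ≤
      β * rho K C D c b τ σ (normM K τ σ (zn - zprev)) zn * t₁) : τn ≤ t₁ := by
  by_contra hlt
  push Not at hlt
  exact hfirst t₁ ht₁ hlt (adaptive_condition_avgPDHG_of_slack K hC hD c b hτ hσ hK hjA hjB hZ
    hslack ht₁ ht)

/-- The first potential of restarted PDHG is controlled by Property 3 at `z^{0,0}`:
`ρ_{‖z^{1,0} − z^{0,0}‖}(z^{1,0}) ≤ (4/τ₀) · dist_M(z^{0,0}, Z*)`.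
[cite: XiongFreund2024, Theorem 3.5 (proof, (3.26) with n = 1)]
[cite: ApplegateEtAl2022, Theorem 2 (proof)] -/
theorem first_potential_avgPDHG_le [FiniteDimensional ℝ X] [FiniteDimensional ℝ Y]
    (K : X →L[ℝ] Y) {C : Set X} {D : Set Y} (hC : Convex ℝ C) (hD : Convex ℝ D) (c : X) (b : Y)
    {τ σ : ℝ} (hτ : 0 < τ) (hσ : 0 < σ) (hK : τ * σ * ‖K‖ ^ 2 ≤ 1) {jA : X → X} {jB : Y → Y}
    (hjA : IsResolventMap τ (shiftOp c (normalCone C)) jA)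
    (hjB : IsResolventMap σ (shiftOp b (normalCone D)) jB)
    (hZ : (saddleSet K C D c b).Nonempty) {z : ℕ → X × Y} {τs : ℕ → ℕ} (hτs : ∀ n, τs n ≠ 0)
    (hz : ∀ n, z (n + 1) = avgPDHG K τ σ jA jB (τs n) (z n)) :
    rho K C D c b τ σ (normM K τ σ (z 1 - z 0)) (z 1) ≤
      4 / τs 0 * infDistM K τ σ (z 0) (saddleSet K C D c b) := by
  set Zs := saddleSet K C D c b with hZs
  have hτ0 : (0 : ℝ) < τs 0 := Nat.cast_pos.mpr (Nat.pos_of_ne_zero (hτs 0))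
  have h1 : rho K C D c b τ σ (normM K τ σ (z 1 - z 0)) (z 1) ≤
      2 * normM K τ σ (z 1 - z 0) / τs 0 := by
    have h := rho_avgPDHG_le K hC hD c b hτ hσ hK hjA hjB (z 0) (hτs 0)
    rw [← hz 0] at h
    exact h
  have h2 : normM K τ σ (z 1 - z 0) ≤ 2 * infDistM K τ σ (z 0) Zs := by
    have h := normM_avgPDHG_sub_le_infDistM K c b hτ hσ hK hjA hjB hZ (z 0) (hτs 0)
    rw [← hz 0] at h
    exact h
  calc rho K C D c b τ σ (normM K τ σ (z 1 - z 0)) (z 1)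
      ≤ 2 * normM K τ σ (z 1 - z 0) / τs 0 := h1
    _ ≤ 2 * (2 * infDistM K τ σ (z 0) Zs) / τs 0 :=
        div_le_div_of_nonneg_right (by linarith) hτ0.le
    _ = 4 / τs 0 * infDistM K τ σ (z 0) Zs := by
        field_simp
        ring

/-- **[XiongFreund2024, Theorem 3.5] for restarted PDHG — iteration complexity under sharpness WITH
SLACK.** Let `z^{n+1,0} = z̄^{τ_n}(z^{n,0})` be the restart points of adaptively restarted PDHG
(`β ∈ (0,1)`; restart condition `g_{n+1} ≤ β g_n` on the potentials
`g_n = ρ_{‖z^{n+1,0} − z^{n,0}‖_M}(z^{n+1,0})`, each restart at the FIRST inner length meeting it),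
and assume the relaxed sharpness hypothesis (3.19): `dist_M(z^{n+1,0}, Z*) ≤ L·g_n + C'` for all `n`
(`L, C' ≥ 0`). If `g_0, …, g_{N−2} > ε` (no potential `≤ ε` has occurred before restart `N ≥ 1`), then
the number of PDHG steps spent up to restart `N` satisfies
`Σ_{n<N} τ_n ≤ τ_0 + (N − 1)(1 + 4L/β) + 4C'/(β ε (1 − β))`,
and (`lt_pow_mul_of_potentials_gt_avgPDHG`) `(N − 2)·log(1/β) < log(4 dist_M(z^{0,0}, Z*)/(τ_0 ε))` —
the printed (3.20) `T ≤ 23L ln(23 Dist_M(z^{0,0}, Z*)/ε) + 35C/ε` (there `β = 1/e`, `τ_0 = 1`, constant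
`8`): LINEAR convergence down to the scale `C'`, then `O(C'/ε)`. For `C' = 0` this is the linear rate
of [ApplegateEtAl2022, Theorem 2] with an iteration count; for the cell's SDP legs `C' > 0` is forced
in general (`SemidefiniteSharpnessFailure.not_isSharpOn_sdp`) and is supplied by the sublevel-set
geometry [XiongFreund2024, Lemma 3.13]. The recursion `z^{n+1,0} = z̄^{τ_n}(z^{n,0})` enters only
through the hypotheses, so it is not repeated as one.
[cite: XiongFreund2024, Theorem 3.5] -/
theorem sum_adaptive_lengths_avgPDHG_le_of_slack [FiniteDimensional ℝ X] [FiniteDimensional ℝ Y]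
    (K : X →L[ℝ] Y) {C : Set X} {D : Set Y} (hC : Convex ℝ C) (hD : Convex ℝ D) (c : X) (b : Y)
    {τ σ : ℝ} (hτ : 0 < τ) (hσ : 0 < σ) (hK : τ * σ * ‖K‖ ^ 2 ≤ 1) {jA : X → X} {jB : Y → Y}
    (hjA : IsResolventMap τ (shiftOp c (normalCone C)) jA)
    (hjB : IsResolventMap σ (shiftOp b (normalCone D)) jB)
    (hZ : (saddleSet K C D c b).Nonempty) {β L C' ε : ℝ} (hβ0 : 0 < β) (hβ1 : β < 1) (hL : 0 ≤ L)
    (hC' : 0 ≤ C') (hε : 0 < ε) {z : ℕ → X × Y} {τs : ℕ → ℕ}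
    (hcond : ∀ n, rho K C D c b τ σ (normM K τ σ (z (n + 2) - z (n + 1))) (z (n + 2)) ≤
      β * rho K C D c b τ σ (normM K τ σ (z (n + 1) - z n)) (z (n + 1)))
    (hfirst : ∀ n t : ℕ, t ≠ 0 → t < τs (n + 1) →
      ¬ rho K C D c b τ σ (normM K τ σ (avgPDHG K τ σ jA jB t (z (n + 1)) - z (n + 1)))
          (avgPDHG K τ σ jA jB t (z (n + 1))) ≤
        β * rho K C D c b τ σ (normM K τ σ (z (n + 1) - z n)) (z (n + 1)))
    (hslack : ∀ n, infDistM K τ σ (z (n + 1)) (saddleSet K C D c b) ≤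
      L * rho K C D c b τ σ (normM K τ σ (z (n + 1) - z n)) (z (n + 1)) + C')
    {N : ℕ} (hN : 1 ≤ N)
    (hpot : ∀ k, k + 2 ≤ N → ε < rho K C D c b τ σ (normM K τ σ (z (k + 1) - z k)) (z (k + 1))) :
    (∑ n ∈ Finset.range N, (τs n : ℝ)) ≤
      τs 0 + ((N : ℝ) - 1) * (1 + 4 * L / β) + 4 * C' / β * (ε * (1 - β))⁻¹ := by
  set g : ℕ → ℝ := fun k => rho K C D c b τ σ (normM K τ σ (z (k + 1) - z k)) (z (k + 1)) with hg
  have hcond' : ∀ n, g (n + 1) ≤ β * g n := fun n => hcond n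
  -- the per-restart inner-length bound (3.24)
  have hlen : ∀ k, k + 2 ≤ N → (τs (k + 1) : ℝ) ≤ 1 + 4 * L / β + 4 * C' / β * (g k)⁻¹ := by
    intro k hk
    have hgk : 0 < g k := hε.trans (hpot k hk)
    set x : ℝ := 4 * (L * g k + C') / (β * g k) with hx
    have hx0 : 0 ≤ x := by positivity
    set t₁ : ℕ := ⌊x⌋₊ + 1 with ht₁
    have ht₁1 : t₁ ≠ 0 := Nat.succ_ne_zero _
    have hxt : x < t₁ := by rw [ht₁]; push_cast; exact Nat.lt_floor_add_one x
    have hineq : 4 * (L * g k + C') ≤ β * g k * t₁ := by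
      have hβg : 0 < β * g k := mul_pos hβ0 hgk
      have := (div_lt_iff₀ hβg).mp hxt
      linarith
    have hτle : τs (k + 1) ≤ t₁ :=
      adaptive_length_avgPDHG_le_of_slack K hC hD c b hτ hσ hK hjA hjB hZ (hslack k) (hfirst k)
        ht₁1 hineq
    have hτle' : (τs (k + 1) : ℝ) ≤ t₁ := by exact_mod_cast hτle
    have ht₁le : (t₁ : ℝ) ≤ x + 1 := by
      rw [ht₁]; push_cast; linarith [Nat.floor_le hx0]
    have hxe : x = 4 * L / β + 4 * C' / β * (g k)⁻¹ := by
      rw [hx]; field_simp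
    linarith [hτle', ht₁le, hxe]
  exact PrimalDualRestartSharpness.sum_lengths_le hβ0.le hβ1 hε (by positivity : 0 ≤ 4 * C' / β)
    hcond' hN hpot hlen

/-- **The number of restarts before convergence (PDHG)** [XiongFreund2024, Theorem 3.5 (proof,
(3.26)–(3.27))]: if the potentials `g_0, …, g_{N−2}` of adaptively restarted PDHG all exceed `ε`, then
`ε < β^{N−2} · (4/τ_0) · dist_M(z^{0,0}, Z*)`. [cite: XiongFreund2024, Theorem 3.5 (proof, (3.26)–(3.27))] -/
theorem lt_pow_mul_of_potentials_gt_avgPDHG [FiniteDimensional ℝ X] [FiniteDimensional ℝ Y]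
    (K : X →L[ℝ] Y) {C : Set X} {D : Set Y} (hC : Convex ℝ C) (hD : Convex ℝ D) (c : X) (b : Y)
    {τ σ : ℝ} (hτ : 0 < τ) (hσ : 0 < σ) (hK : τ * σ * ‖K‖ ^ 2 ≤ 1) {jA : X → X} {jB : Y → Y}
    (hjA : IsResolventMap τ (shiftOp c (normalCone C)) jA)
    (hjB : IsResolventMap σ (shiftOp b (normalCone D)) jB)
    (hZ : (saddleSet K C D c b).Nonempty) {β ε : ℝ} (hβ0 : 0 ≤ β) {z : ℕ → X × Y} {τs : ℕ → ℕ}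
    (hτs : ∀ n, τs n ≠ 0) (hz : ∀ n, z (n + 1) = avgPDHG K τ σ jA jB (τs n) (z n))
    (hcond : ∀ n, rho K C D c b τ σ (normM K τ σ (z (n + 2) - z (n + 1))) (z (n + 2)) ≤
      β * rho K C D c b τ σ (normM K τ σ (z (n + 1) - z n)) (z (n + 1)))
    {N : ℕ} (hN : 2 ≤ N)
    (hpot : ∀ k, k + 2 ≤ N → ε < rho K C D c b τ σ (normM K τ σ (z (k + 1) - z k)) (z (k + 1))) :
    ε < β ^ (N - 2) * (4 / τs 0 * infDistM K τ σ (z 0) (saddleSet K C D c b)) := by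
  set g : ℕ → ℝ := fun k => rho K C D c b τ σ (normM K τ σ (z (k + 1) - z k)) (z (k + 1)) with hg
  have hcond' : ∀ n, g (n + 1) ≤ β * g n := fun n => hcond n
  have h1 : ε < g (N - 2) := hpot (N - 2) (by omega)
  have h2 : g (N - 2) ≤ β ^ (N - 2) * g 0 := by
    have h := PrimalDualRestartSharpness.potential_add_le_pow_mul hβ0 hcond' 0 (N - 2)
    rwa [zero_add] at h
  have h3 : g 0 ≤ 4 / τs 0 * infDistM K τ σ (z 0) (saddleSet K C D c b) :=
    first_potential_avgPDHG_le K hC hD c b hτ hσ hK hjA hjB hZ hτs hz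
  exact h1.trans_le (h2.trans (mul_le_mul_of_nonneg_left h3 (pow_nonneg hβ0 _)))

/-- The logarithmic form of the restart count for PDHG [XiongFreund2024, Theorem 3.5 (proof,
(3.27))]: `(N − 2)·log(1/β) < log(4 dist_M(z^{0,0}, Z*)/(τ_0 ε))` whenever `g_0, …, g_{N−2} > ε`
(`0 < β`, `N ≥ 2`) — `N = O(log(dist_M(z^{0,0}, Z*)/ε))` restarts.
[cite: XiongFreund2024, Theorem 3.5 (proof, (3.27))] -/
theorem restart_count_lt_of_potentials_gt_avgPDHG [FiniteDimensional ℝ X] [FiniteDimensional ℝ Y]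
    (K : X →L[ℝ] Y) {C : Set X} {D : Set Y} (hC : Convex ℝ C) (hD : Convex ℝ D) (c : X) (b : Y)
    {τ σ : ℝ} (hτ : 0 < τ) (hσ : 0 < σ) (hK : τ * σ * ‖K‖ ^ 2 ≤ 1) {jA : X → X} {jB : Y → Y}
    (hjA : IsResolventMap τ (shiftOp c (normalCone C)) jA)
    (hjB : IsResolventMap σ (shiftOp b (normalCone D)) jB)
    (hZ : (saddleSet K C D c b).Nonempty) {β ε : ℝ} (hβ0 : 0 < β) (hε : 0 < ε) {z : ℕ → X × Y}
    {τs : ℕ → ℕ} (hτs : ∀ n, τs n ≠ 0) (hz : ∀ n, z (n + 1) = avgPDHG K τ σ jA jB (τs n) (z n))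
    (hcond : ∀ n, rho K C D c b τ σ (normM K τ σ (z (n + 2) - z (n + 1))) (z (n + 2)) ≤
      β * rho K C D c b τ σ (normM K τ σ (z (n + 1) - z n)) (z (n + 1)))
    {N : ℕ} (hN : 2 ≤ N)
    (hpot : ∀ k, k + 2 ≤ N → ε < rho K C D c b τ σ (normM K τ σ (z (k + 1) - z k)) (z (k + 1))) :
    ((N : ℝ) - 2) * Real.log (1 / β) <
      Real.log (4 / τs 0 * infDistM K τ σ (z 0) (saddleSet K C D c b) / ε) := by
  set A : ℝ := 4 / τs 0 * infDistM K τ σ (z 0) (saddleSet K C D c b) with hA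
  have h := lt_pow_mul_of_potentials_gt_avgPDHG K hC hD c b hτ hσ hK hjA hjB hZ hβ0.le hτs hz
    hcond hN hpot
  rw [← hA] at h
  have hβN : 0 < β ^ (N - 2) := pow_pos hβ0 _
  have hApos : 0 < A := by
    by_contra hle
    push Not at hle
    have : β ^ (N - 2) * A ≤ 0 := mul_nonpos_of_nonneg_of_nonpos hβN.le hle
    linarith
  have hlog := Real.log_lt_log hε h
  rw [Real.log_mul hβN.ne' hApos.ne', Real.log_pow] at hlog
  have hN2 : ((N - 2 : ℕ) : ℝ) = (N : ℝ) - 2 := by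
    rw [Nat.cast_sub hN]; push_cast; ring
  rw [hN2] at hlog
  rw [one_div, Real.log_inv, Real.log_div hApos.ne' hε.ne']
  linarith

end Literature.Analysis.Convex.RestartedPDHG
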